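import Literature.AlgebraicGeometry.Deformation.CurvilinearObstructionsDoNotGenerate
import Mathlib.RingTheory.PowerSeries.Derivative
import Mathlib.RingTheory.PowerSeries.Inverse
import Mathlib.RingTheory.PowerSeries.NoZeroDivisors
import Mathlib.Algebra.DualNumber
import Mathlib.LinearAlgebra.Complex.Module
import Literature.RingTheory.MvPowerSeries.PartialDerivative
import HarnessLib

/-!
# [BF03] Remark 6.9: over a base `A ≠ k`, curvilinear derivation lifting does not imply smoothness —
# the `A`-algebra `B = A[[T]]/(ā T)`, `a` integral over `I` but `a ∉ I`, AS PRINTED, with the verification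
# the source leaves to the reader; the arc criterion for integral dependence of [BF03, §9] it rests on («only if»
# half), and that criterion's other printed use, [BF03] Theorem 9.2 (1): curvilinear extensions annihilate the
# integral closure of `𝔪I` (the inclusion `Ex^c ⊆ Hom(I/J, k)`; with the sharpness of «`k` algebraically closed»
# for the printed equality, on [FM99, Ex. 2.3]'s `(x³, y³, x² + y²)`: strict over `ℝ`, equality over `ℂ`)

Family `hodge` (computation cell `pub-hsemireg`, LIT-W seat «Kawamata ∕ Ran T¹-lifting as printed»), layer
`Literature/AlgebraicGeometry/Deformation`; companion of `CurvilinearJacobianCriterion.lean` ([BuchweitzFlenner2003,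
Lemma 6.8] over a point: (5) ⇒ (1)) and of the two [FantechiManetti1998ObstructionCalculus, Example 5.7]
counterexamples `RelativeCurvilinearLiftingNotSmooth.lean` ∕ `RelativeCurvilinearLiftingNonClosedField.lean`
(relative curvilinear LIFTING OF POINTS does not imply smoothness). Built on `CurvilinearObstructionsDoNotGenerate.lean`
(the truncations `T1Lifting.truncAlg : k[[t]] → A_n = k[t]/(t^{n+1})` and ARCS LIFT `T1Lifting.exists_arc_comp_eq`:
every `k`-algebra map `k[[X_1, …, X_r]] → A_n` is the reduction of an arc `k[[X]] → k[[t]]`,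
[FantechiManetti1998ObstructionCalculus, Lemma 5.5]; the curvilinear obstructions
`ArtinFunctor.ObstructionSpace.curvilinearObstructions` of [FantechiManetti1998ObstructionCalculus, Def. 3.5] and their
arc description `ProRep.mem_curvilinearObstructions_iff_exists_powerSeries_arc` = [FantechiManetti1998ObstructionCalculus,
Lemma 5.5] for `(T²_{P/I})^∨ = I/𝔪_P I = ProRep.IModMI`), on `T1Lifting.lean` (`A_n = T1Lifting.A k n` with
augmentation `T1Lifting.augA`, `T1Lifting.i : A_{M+1} → A_M`), on Mathlib's formal derivative
`PowerSeries.derivative` (`d⁄dT` on `A[[T]]`), for §7 on Mathlib's dual numbers `DualNumber k = k[ε]` (the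
curvilinear algebra `k[[X]]/(X²)`), and for §8 on `ℂ` over `ℝ` (`Mathlib.LinearAlgebra.Complex.Module`) and the tree's
[FantechiManetti1999T1Lifting, Ex. 2.3] file (`FM99Example23.I23`, `.T2R`, `.apply_cls_cube_eq_zero_of_mem_span` in
`CurvilinearObstructionsDoNotGenerate.lean`), and for §9 on the tree's coefficientwise partial derivatives
`Literature.RingTheory.MvPowerSeries.pd` (`PartialDerivative.lean`: `pd_mul`, `pd_C`, `pd_X`). THEOREMS only (no definition, no named fact, no `sorry`); any field `k`
in place of `ℂ`, formal power series in place of «complete analytic».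

## Source, verbatim ([BuchweitzFlenner2003] = R.-O. Buchweitz, H. Flenner, «A semiregularity map for modules and
applications to deformations», Compositio Math. 137 (2003) 135–210, p. 184 (journal text layer
HOME/lit/BuchweitzFlenner2003-Compositio137/text-pages/p0050 l. 35–40 = arXiv math/9912245 TeX, store
paper:arxiv-math_9912245 chunk p0030), right after the proof of LEMMA 6.8 — whose conditions are «(1) There is an ideal `𝔞 ⊆ A`
and an isomorphism of `A`-algebras `B ≅ (A/𝔞)[[T_1, …, T_k]]` for some `k ≥ 0`; (2) The `B`-module `Ω¹_{B/A}` is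
free; (3) The functor `M ↦ Der_A(B, M)` is right exact on finite `B`-modules; (4) With `B_n := B/𝔪_B^{n+1}`, the
natural map `Der_A(B, B_n) → Der_A(B, ℂ)` is surjective for all `n`. If `A = ℂ`, then these conditions are also
equivalent to: (5) The natural map `Der_ℂ(B, C) → Der_ℂ(B, ℂ)` is surjective for any artinian curvilinear
`B`-algebra `C ≅ ℂ[[X]]/(Xⁿ)`.»):

«REMARK 6.9. In case `A ≠ ℂ`, the condition (5) above is no longer equivalent to the other ones as the following
example shows. Consider a `ℂ`-algebra `A ≅ R/I`, with `R ≅ ℂ[[X_1, …, X_k]]`, and assume that there is an element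
`a ∈ R` that is integral over `I` but not in `I`. If `ā` denotes the residue class of `a` in `A`, then the reader
may verify that the `A`-algebra `B := A[[T]]/(āT)` satisfies (5) although it is not smooth over a quotient of `A`.»

And, from §9 «Appendix: Infinitesimal deformations and integral dependence» (pp. 204–205; TeX store p0041): «We recall
first the definition of integral dependence, see [ZSa1]. Let `R` be a ring and `I ⊆ R` an ideal. An element `x ∈ R`
is integral over `I` if there is an equation `xⁿ + a_1 x^{n-1} + ⋯ + a_n = 0` with `a_ν ∈ I^ν`. … We remind the
reader of the following criterion for integral dependence that we formulate for our purposes as follows. Let `k` be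
an algebraically closed field and let `A = (A, 𝔪)` be a local noetherian complete `k`-algebra with residue field
`k`. If `I ⊆ 𝔪` is an ideal, then `f` is in the integral closure of `I` if and only if for every "arc"
`α : A → k[[T]]` the element `α(f)` is contained in `α(I)k[[T]]`.»; SIT 9.1: «`Λ → A` … `A ≅ R/I` with
`R := Λ[[X_1, …, X_s]]` and `I ⊆ 𝔪_Λ R + (X_1, …, X_s)²` … `T¹_{A/Λ}(k) ≅ Hom_A(I, k). (**)` … `Ex^c_{A/Λ}(k)`,
the space of curvilinear extensions. This is by definition the subspace generated by all curvilinear extensions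
`[A']`, which are those extensions that fit into a commutative diagram of `Λ`-algebras
`0 → k → A' → A → 0` over `0 → k → k[[t]]/(t^{n+1}) → k[[t]]/(tⁿ) → 0` (D)»; «THEOREM 9.2. 1. If `k` is
algebraically closed then under the isomorphism (**) the subspace `Ex^c_{A/Λ}(k)` of `T¹_{A/Λ}(k)` corresponds to
the subspace `Hom_A(I/J, k)` of `Hom_A(I, k)`, where `J` is the integral closure of `𝔪I` in `I`.»; proof: «For
(1), let `A'` be a curvilinear extension of `A` by `k` and let `p' : R → A'` be a morphism of `Λ`-algebras lifting
the given map `p : R → A`, so that `φ_{A'} = p'|I : I → k` corresponds under (**) to the extension `[A']`. By the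
valuative criterion of integral dependence mentioned above, `J` is in the kernel of `p'`, whence
`φ_{A'} ∈ Hom_A(I/J, k)`. Thus `Ex^c_{A/Λ}(k) ⊆ Hom_A(I/J, k)`. To show equality, …».

## What is typed (hypotheses one per line)

* (R.a) `k` any field (print: `ℂ`); `R = k[[X_1, …, X_r]] = MvPowerSeries (Fin r) k`; `I ⊆ R` an ideal; `A = R ⧸ I`.
* (R.b) `a ∈ R`, `a ∉ I`, INTEGRAL OVER `I` in the sense the paper itself recalls in its §9 «Appendix: Infinitesimal
  deformations and integral dependence» (p. 204: «Let `R` be a ring and `I ⊆ R` an ideal. An element `x ∈ R` is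
  integral over `I` if there is an equation `xⁿ + a_1 x^{n-1} + ⋯ + a_n = 0` with `a_ν ∈ I^ν`.»), spelled out as
  data `(N, c, hc, ha)`: `a^N + Σ_{j=1}^{N} c_j a^{N-j} = 0`, `c_j ∈ I^j` — Mathlib has integrality over subrings
  only.
* (R.c) `B = A[[T]]/(ā·T) = PowerSeries A ⧸ Ideal.span {C ā * X}`, an `A`-algebra through `A → A[[T]] → B`.
* (R.d) CONDITION (5) FOR THE `A`-ALGEBRA `B`, i.e. with `Der_A(−, −)` as in (2)–(4) of the Lemma (for `A = k` this
  is (5) verbatim): for every artinian curvilinear `B`-algebra `C = A_n = k[t]/(t^{n+1})` the natural map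
  `Der_A(B, A_n) → Der_A(B, k)` (composition with `A_n → k`) is onto. PRESENTED on `A[[T]]`, as in
  `CurvilinearJacobianCriterion.lean`: a `B`-algebra structure on `A_n` is a `k`-algebra map `ψ : A[[T]] → A_n`
  killing `(ā·T)`; an `A`-derivation `B → A_n` is a `k`-linear `δ : A[[T]] → A_n`, Leibniz along `ψ`, vanishing on
  `A` and on `(ā·T)`; an `A`-derivation `B → k` is a `k`-linear `d : A[[T]] → k`, Leibniz along the point
  `augA ∘ ψ : A[[T]] → k`, vanishing on `A`. The typed statement quantifies over ALL `k`-algebra maps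
  `ψ : A[[T]] → A_n` (those through `B` included) and does not ask `d` to kill `(ā·T)` (it does automatically), and
  still produces `δ` killing `A` AND `(ā·T)` with `augA ∘ δ = d` — formally stronger, same content. That (5) MUST be
  read over `A` here is itself typed (§7): with absolute derivations `Der_k` the claim fails for this very `B`.
* (R.e) «not smooth over a quotient of `A`» = the negation of (1): there is NO ideal `𝔞 ⊆ A`, no `m ≥ 0` and no
  `A`-algebra isomorphism `B ≃ₐ[A] (A ⧸ 𝔞)[[T_1, …, T_m]] = MvPowerSeries (Fin m) (A ⧸ 𝔞)`.
* (R.f) The converse direction (1) ⇒ (5) OVER THE BASE (§9): for `B = A'[[X_1, …, X_m]]` over any commutative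
  `k`-algebra `A'` (= (1) with `A' = A/𝔞`), every `A'`-derivation over a point of `A_n` lifts along it — so that, as
  typed, (1) ⇒ (5)_A strictly (print, p. 184, for `A = ℂ`: «The implications (1) ⇒ (2) ⇒ (3) ⇒ (4) ⇒ (5) are
  obvious»).
* (T.a) For Thm. 9.2 (1): `Λ = k` (any field), `A = P/I`, `P = k[[x_1, …, x_n]]`, `I ⊆ 𝔪_P²` (Sit. 9.1 with
  `𝔪_Λ = 0`); `(T²_A)^∨ = I/𝔪_P I` (`ProRep.IModMI`), `Hom_A(I, k) = (I/𝔪_P I)^∨` (print's (**));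
* (T.b) the curvilinear extensions `[A']` of `A` by `k` (diagram (D)) ARE, through `φ_{A'} = p'|I`, the curvilinear
  obstructions of the points of `h_A` along `e_M : A_{M+1} → A_M` ([FantechiManetti1998ObstructionCalculus, Def. 3.5];
  tree `ArtinFunctor.ObstructionSpace.curvilinearObstructions` of `ArtinFunctor.powerSeriesPointsObstructionSpace`),
  and `Ex^c` = their `k`-span — this dictionary is the typed reading of «corresponds under (**)»;
* (T.c) `x ∈ I` integral over `𝔪_P·I` (equation of integral dependence as in (R.b), coefficients in `(𝔪_P I)^j`) —
  i.e. `x ∈ J`; CONCLUSION typed: `v([x]) = 0` for every `v` in the span of the curvilinear obstructions — the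
  INCLUSION `Ex^c ⊆ Hom_A(I/J, k)` only;
* (T.d) the printed hypothesis «`k` algebraically closed» of the EQUALITY is shown NECESSARY (§8): for `k = ℝ` and
  [FantechiManetti1999T1Lifting, Ex. 2.3]'s `I = (x³, y³, x² + y²) ⊆ ℝ[[x, y]]` the inclusion is strict — while over
  `ℂ` (§10) the curvilinear obstructions of the same `I` span all of `T²_R`, the equality 9.2 (1) predicts.

## The verification («the reader may verify»), as proved here

* §1 `BF03Remark69.X_pow_dvd_arc_of_isIntegralOver` — the «only if» half of the p. 205 arc criterion, graded: for an
  arc `w : R → k[[t]]` with `w(K) ⊆ (t^q)` and `x` integral over `K`, `w(x) ∈ (t^q)` (`w(c_j) ∈ (t^{qj})`; if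
  `w(x) = t^α·u`, `u(0) ≠ 0`, `α < q`, the equation gives `t^{αN+1} ∣ w(x)^N = t^{αN} u^N`, contradicting `t ∤ u` —
  `k[[t]]` a domain, `t` prime); and `BF03Remark69.algHom_apply_eq_zero_of_isIntegralOver`: EVERY `k`-algebra map
  `φ : R → A_n` killing `I` kills `a` (lift `φ` to an arc, `T1Lifting.exists_arc_comp_eq`; `w(I) ⊆ (t^{n+1})`).
* §2 `BF03Remark69.derivationLifting_of_map_eq_zero`: for any commutative `k`-algebra `A`, `b ∈ A` and
  `ψ : A[[T]] → A_n` with `ψ(b) = 0`, every `A`-derivation `d` over the point lifts: `δ(f) := ψ(∂f/∂T)·d(T)` is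
  Leibniz along `ψ`, kills `A`, kills `(b·T)` BECAUSE `ψ(b) = 0`, and `δ ≡ d mod t` (write `f = T·h + f(0)`, use
  `ψ(T) ≡ 0 mod t` — `augA_map_X_eq_zero`: a `k`-algebra map to the local ring `A_n` sends `T` to a non-unit).
  With §1 (`ψ|_A` kills `ā`) this is (5) for `B`.
* §3 `BF03Remark69.not_nonempty_algEquiv_mvPowerSeries_quotient`: for a LOCAL ring `A` and `b ∈ 𝔪_A ∖ {0}`,
  `A[[T]]/(b·T)` is not `A`-isomorphic to any `(A/𝔞)[[T_1, …, T_m]]`: `A → B` is injective (constant terms), the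
  image `g` of the class `τ` of `T` satisfies `b·g = 0`; for `m ≥ 1`, `B = A + τ·B` transported to
  `T_1 = x + g·y` and the coefficient of `T_1` show that `g` has a unit coefficient (`A/𝔞` local), so `b ∈ 𝔞`,
  so `b ↦ 0 ∈ B`, so `b = 0`; for `m = 0`, `τ` is a constant `x`, `T - x ∈ (b·T)`, and `b` is a unit.
* §4 `BF03Remark69.relativeCurvilinearDerivationLifting_and_not_smooth`: the Remark for `A = R/I`, `a` as in
  (R.b) (`ā ≠ 0` as `a ∉ I`; `ā ∈ 𝔪_A` as `a^N ∈ I ⊆ 𝔪_R`; `A` local).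
* §5 `BF03Remark69.example_isIntegralOver_not_mem`: the hypotheses are met by `R = k[[X_0, X_1]]`,
  `I = (X_0², X_1²)`, `a = X_0 X_1` (`a² = X_0² X_1² ∈ I²`, and no element of `I` has an `X_0 X_1`-coefficient).
* §7 `BF03Remark69.absoluteDerivationLifting_fails` — the honest-scope witness: for §5's data and `2 ≠ 0` in `k`,
  the `B`-algebra `k[ε]` (`X_0 ↦ ε`, `X_1, T ↦ 0`) and the `k`-derivation `d = ε`-part of `ψ` admit NO `k`-derivation
  `δ : B → k[ε]` along `ψ` over `d` (`0 = δ(X_0²) = 2ε·δ(X_0)`, `δ(X_0) ≡ 1 mod ε`): `Der_k(B, k[ε]) → Der_k(B, k)` is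
  not onto, so the literal `Der_ℂ`-wording of (5) cannot be what the Remark asserts for `A ≠ ℂ`.
* §8 SHARPNESS of «`k` algebraically closed» in Thm. 9.2 (1): `FM99Example23.cls_eq_zero_of_isIntegralOver_real`
  (over `ℝ`, for `I = (x³, y³, x² + y²)`: every element of `I` integral over `𝔪I` has zero class in `I/𝔪I`, i.e.
  `J/𝔪I = 0` and `Hom_A(I/J, ℝ) = (I/𝔪I)^∨` — base change to `ℂ[[x, y]]`, then §1's arc criterion along the complex
  arcs `x ↦ t, y ↦ it` and `x ↦ t + t², y ↦ it`, which send `I` into `(t³)` and `𝔪I` into `(t⁴)`);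
  `FM99Example23.cls_X_cube_ne_zero` (`[x³] ≠ 0`, by the functional `coeff_{x³} − coeff_{xy²}` which kills `𝔪I`);
  `FM99Example23.curvilinearObstructions_span_lt_annihilator_real` (hence some `v ∈ (I/𝔪I)^∨ = Hom_A(I/J, ℝ)` lies
  outside the span of the curvilinear obstructions, which kill `[x³]` by the tree's
  `FM99Example23.apply_cls_cube_eq_zero_of_mem_span`: `Ex^c ⊊ Hom_A(I/J, ℝ)`). [BuchweitzFlenner2003] prints
  9.2 (1) under «If `k` is algebraically closed» with no sharpness remark of its own — the necessity is this file's
  theorem; the ring is print's sharpness example for [FantechiManetti1999T1Lifting, Thm. 2.2]: «Example 2.3. If `k` is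
  not algebraically closed then theorem 2.2 may fail. Assume for instance that `k = ℝ`, and let
  `R = k[x, y]/(x³, y³, x² + y²)`. Then `x³, y³ ∈ T²∨_R` are in the kernel of every curvilinear obstruction; hence
  `dim R = 0`, `dim T¹_R = 2`, `dim T^{2c}_R = 1`.» (cf. the cousin [FantechiManetti1998ObstructionCalculus, Ex. 5.7
  (iii)] — a different example, the morphism `h_S → h_R` for `(x² + y²)` and `(x², y²)` over `ℝ` — and p. 562 «if `k`
  is not algebraically closed then Proposition 5.8 may fail, cf. Example 5.7(iii)»).
* §10 `FM99Example23.span_curvilinearObstructions_eq_top_complex` — over `ℂ` the curvilinear obstructions of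
  `ℂ[[x, y]]/(x³, y³, x² + y²)` span ALL of `T²_R`: the arcs `(t, it)`, `(t, −it)`, `(t + t², it)` define
  (`FM99Example23.exists_curvilinearObstruction_of_arc`, the «if» direction of [FantechiManetti1998ObstructionCalculus,
  Lemma 5.5] in the tree) curvilinear obstructions with values `(1, −i, 0)`, `(1, i, 0)`, `(1, −i, 2)` on
  `[x³], [y³], [x² + y²]`, and a form is determined by these values (tree `FM99Example23.dual_eq_zero_of_apply_cls_eq_zero`)
  — the kernel version of lit-3's pencil «over `ℂ`, `u = x + iy`, `v = x − iy` give `I_ℂ = (uv, u³, v³)` whose three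
  dual classes are curvilinear obstructions».
* §9 `BF03Remark69.derivationLifting_mvPowerSeries` — (1) ⇒ (5) over an arbitrary base: for `B = A'[[X_1, …, X_m]]`
  and `ψ : B → A_n`, `δ(f) := Σ_i ψ(∂f/∂X_i)·d(X_i)` lifts `d` (Leibniz by `pd_mul`; kills `A'` by `pd_C`;
  `augA ∘ δ = d` through the decomposition `f = f(0) + Σ_j X_j g_j` — `exists_eq_C_add_sum_X_mul`, any coefficient
  ring — and `ψ(X_j) ≡ 0 mod t`).
* §6 [BuchweitzFlenner2003, Thm. 9.2 (1)], the inclusion: `ProRep.algHom_apply_eq_zero_of_isIntegralOver_maximalIdeal_mul`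
  («`J` is in the kernel of `p'`»: every `φ : P → A_{M+1}` whose reduction mod `t^{M+1}` kills `I` kills every `x`
  integral over `𝔪_P I` — arcs send `𝔪_P` into `(t)`, so `w(𝔪_P I) ⊆ (t^{M+2})`);
  `ProRep.curvilinearObstruction_apply_cls_eq_zero_of_isIntegralOver` (every curvilinear obstruction `v` has
  `v([x]) = 0` — print's route: «`J ⊆ ker p'`» fed into the tree's `ProRep.curvilinearObstruction_apply_cls_eq_zero`,
  the [FantechiManetti1998ObstructionCalculus, Lemma 5.2]-reading of `ob_e(a)` as `p'|I`);
  `ProRep.span_curvilinearObstructions_apply_cls_eq_zero_of_isIntegralOver` (the same for the span = `Ex^c`).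

HONEST SCOPE. `ℂ` → any field, «complete analytic» → formal; (5) is read over `A` (with `Der_A`, the reading under
which the Remark is a statement about the relative Lemma 6.8 — §7 types that the absolute `Der_k` reading FAILS for
the Remark's own `B`, so this is a reading forced by print, not a choice);
derivations are presented on `A[[T]]` (Leibniz maps along `ψ`), not as Mathlib `Derivation` terms on the quotient;
the positive conditions (2), (3), (4) of Lemma 6.8 for this `B` are not typed (print only claims (5) and ¬(1)); of
the relative Lemma 6.8 only (1) ⇒ (5)_A is typed (§9) — (4) ⇒ (1) (Lipman–Zariski), (2), (3) are not;
of Thm. 9.2 only part (1) and only its inclusion `⊆` is typed — the EQUALITY (print: `k` algebraically closed; the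
«if» half of the arc criterion) is NOT typed in general, but its hypothesis `k = k̄` is shown necessary (§8, `k = ℝ`)
and the equality is verified over `ℂ` for that one ring (§10); parts (2),
(3) (Jacobi map, `Ext¹(Ω¹, k)`), Prop. 9.3 (Mori–Kawamata dimension bound `dim A ≥ dim R − dim_k I/(J + 𝔪I)`) and
Prop. 9.4 are NOT typed; the base is `Λ = k` (Sit. 9.1 allows any `Λ`); nothing here says any deformation functor of the cell is or is not smooth or which of its obstructions are
curvilinear. Nothing here says HC ∕ HC_CM ∕ HC_AV is proved.
-/

universe u

namespace Literature.AlgebraicGeometry.Deformation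

variable (k : Type u) [Field k]

open T1Lifting

namespace BF03Remark69

/-- `k[[t]] → A_n = k[t]/(t^{n+1})` kills exactly the multiples of `t^{n+1}`. [folklore] -/
private theorem truncAlg_eq_zero_iff_dvd (n : ℕ) (g : PowerSeries k) :
    truncAlg k n g = 0 ↔ (PowerSeries.X : PowerSeries k) ^ (n + 1) ∣ g := by
  change AdjoinRoot.mk _ (PowerSeries.trunc (n + 1) g) = 0 ↔ _
  rw [AdjoinRoot.mk_eq_zero, Polynomial.X_pow_dvd_iff, PowerSeries.X_pow_dvd_iff]
  refine forall_congr' fun d => imp_congr_right fun hd => ?_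
  rw [PowerSeries.coeff_trunc, if_pos hd]

/-- **The arc criterion for integral dependence, «only if» half** ([BuchweitzFlenner2003, §9, p. 205]: «`f` is
in the integral closure of `I` if and only if for every "arc" `α : A → k[[T]]` the element `α(f)` is contained in
`α(I)k[[T]]`»), for `R = k[[X_1, …, X_r]]` and in the graded form used here: if `w : R → k[[t]]` is a `k`-algebra
map with `w(K) ⊆ (t^q)` and `x ∈ R` satisfies an equation of integral dependence over the ideal `K`
(`x^N + c_1 x^{N-1} + ⋯ + c_N = 0`, `c_j ∈ K^j` — p. 204: «An element `x ∈ R` is integral over `I` if there is an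
equation `xⁿ + a_1 x^{n-1} + ⋯ + a_n = 0` with `a_ν ∈ I^ν`»), then `w(x) ∈ (t^q)`. (Then `w(c_j) ∈ (t^{qj})`; if
`w(x) = t^α·u` with `u(0) ≠ 0` and `α < q`, the equation gives `t^{αN+1} ∣ w(x)^N = t^{αN} u^N`, contradicting
`t ∤ u` — `k[[t]]` is a domain and `t` is prime.) Any field `k`; the «if» half (which needs more) is not typed.
[cite: BuchweitzFlenner2003, §9 pp. 204–205] -/
theorem X_pow_dvd_arc_of_isIntegralOver {r : ℕ} (K : Ideal (MvPowerSeries (Fin r) k))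
    {x : MvPowerSeries (Fin r) k} {N : ℕ} (c : ℕ → MvPowerSeries (Fin r) k)
    (hc : ∀ j ∈ Finset.Icc 1 N, c j ∈ K ^ j) (hx : x ^ N + ∑ j ∈ Finset.Icc 1 N, c j * x ^ (N - j) = 0)
    (q : ℕ) (w : MvPowerSeries (Fin r) k →ₐ[k] PowerSeries k)
    (hw : ∀ f ∈ K, (PowerSeries.X : PowerSeries k) ^ q ∣ w f) : (PowerSeries.X : PowerSeries k) ^ q ∣ w x := by
  classical
  have hKj : ∀ j, ∀ f ∈ K ^ j, (PowerSeries.X : PowerSeries k) ^ (q * j) ∣ w f := by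
    intro j f hf
    have hle : Ideal.map w K ≤ Ideal.span {(PowerSeries.X : PowerSeries k) ^ q} := by
      rw [Ideal.map_le_iff_le_comap]
      intro g hg
      rw [Ideal.mem_comap, Ideal.mem_span_singleton]
      exact hw g hg
    have hmem : w f ∈ Ideal.span {(PowerSeries.X : PowerSeries k) ^ q} ^ j := by
      refine Ideal.pow_right_mono hle j ?_
      rw [← Ideal.map_pow]
      exact Ideal.mem_map_of_mem w hf
    rwa [Ideal.span_singleton_pow, Ideal.mem_span_singleton, ← pow_mul] at hmem
  by_contra hdvd
  obtain ⟨d₀, hd₀, hd₀'⟩ : ∃ d, d < q ∧ PowerSeries.coeff d (w x) ≠ 0 := by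
    by_contra h
    exact hdvd (PowerSeries.X_pow_dvd_iff.2 fun m hm => by_contra fun hm' => h ⟨m, hm, hm'⟩)
  have hex : ∃ d, PowerSeries.coeff d (w x) ≠ 0 := ⟨d₀, hd₀'⟩
  obtain ⟨α, hα, hαmin, hαq⟩ :
      ∃ α, PowerSeries.coeff α (w x) ≠ 0 ∧ (∀ d < α, PowerSeries.coeff d (w x) = 0) ∧ α + 1 ≤ q :=
    ⟨Nat.find hex, Nat.find_spec hex, fun d hd => not_not.1 (Nat.find_min hex hd),
      Nat.succ_le_of_lt ((Nat.find_le hd₀').trans_lt hd₀)⟩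
  obtain ⟨u, hu⟩ : (PowerSeries.X : PowerSeries k) ^ α ∣ w x :=
    PowerSeries.X_pow_dvd_iff.2 fun m hm => hαmin m hm
  have hu0 : ¬(PowerSeries.X : PowerSeries k) ∣ u := by
    rw [PowerSeries.X_dvd_iff, ← PowerSeries.coeff_zero_eq_constantCoeff_apply]
    intro h
    apply hα
    rw [hu, PowerSeries.coeff_X_pow_mul', if_pos le_rfl, Nat.sub_self, h]
  have hsum : (PowerSeries.X : PowerSeries k) ^ (α * N + 1) ∣
      ∑ j ∈ Finset.Icc 1 N, w (c j) * w x ^ (N - j) := by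
    refine Finset.dvd_sum fun j hj => ?_
    obtain ⟨hj1, hjN⟩ := Finset.mem_Icc.1 hj
    have h1 : (PowerSeries.X : PowerSeries k) ^ (q * j) ∣ w (c j) := hKj j (c j) (hc j hj)
    have h2 : (PowerSeries.X : PowerSeries k) ^ (α * (N - j)) ∣ w x ^ (N - j) := by
      rw [hu, mul_pow, ← pow_mul]
      exact dvd_mul_right _ _
    have hexp : α * N + 1 ≤ q * j + α * (N - j) := by
      obtain ⟨i, rfl⟩ := Nat.exists_eq_add_of_le hjN
      rw [Nat.add_sub_cancel_left]
      nlinarith [Nat.mul_le_mul_right j hαq]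
    exact (pow_dvd_pow _ hexp).trans (by rw [pow_add]; exact mul_dvd_mul h1 h2)
  have hpow : (PowerSeries.X : PowerSeries k) ^ (α * N + 1) ∣ w x ^ N := by
    have h := congr_arg w hx
    rw [map_add, map_zero, map_pow, map_sum, add_eq_zero_iff_eq_neg] at h
    simp only [map_mul, map_pow] at h
    rw [h]
    exact (dvd_neg).2 hsum
  rw [hu, mul_pow, ← pow_mul, pow_succ] at hpow
  have hX0 : (PowerSeries.X : PowerSeries k) ^ (α * N) ≠ 0 := pow_ne_zero _ PowerSeries.X_ne_zero
  exact hu0 (PowerSeries.X_prime.dvd_of_dvd_pow ((mul_dvd_mul_iff_left hX0).1 hpow))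

/-- **An element integral over `I` dies under every curvilinear point of `A = R/I`.** If `a ∈ R = k[[X_1, …, X_r]]`
is integral over the ideal `I` (p. 204), then `φ(a) = 0` for every `k`-algebra map `φ : R → A_n = k[t]/(t^{n+1})`
with `φ(I) = 0`: lift `φ` to an arc `w : R → k[[t]]` ([FantechiManetti1998ObstructionCalculus, Lemma 5.5],
`T1Lifting.exists_arc_comp_eq`); then `w(I) ⊆ (t^{n+1})`, so `w(a) ∈ (t^{n+1})` by the arc criterion
(`X_pow_dvd_arc_of_isIntegralOver`). This is the first step of «the reader may verify» in
[BuchweitzFlenner2003, Rem. 6.9]. [cite: BuchweitzFlenner2003, §9 pp. 204–205 and Rem. 6.9] -/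
theorem algHom_apply_eq_zero_of_isIntegralOver {r : ℕ} (I : Ideal (MvPowerSeries (Fin r) k))
    {a : MvPowerSeries (Fin r) k} {N : ℕ} (c : ℕ → MvPowerSeries (Fin r) k)
    (hc : ∀ j ∈ Finset.Icc 1 N, c j ∈ I ^ j) (ha : a ^ N + ∑ j ∈ Finset.Icc 1 N, c j * a ^ (N - j) = 0)
    (n : ℕ) (φ : MvPowerSeries (Fin r) k →ₐ[k] A k n) (hφ : ∀ f ∈ I, φ f = 0) : φ a = 0 := by
  obtain ⟨w, hw⟩ := exists_arc_comp_eq k n φ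
  have hker : ∀ f, φ f = 0 ↔ (PowerSeries.X : PowerSeries k) ^ (n + 1) ∣ w f := fun f => by
    rw [← hw, AlgHom.comp_apply, truncAlg_eq_zero_iff_dvd]
  exact (hker a).2 (X_pow_dvd_arc_of_isIntegralOver k I c hc ha (n + 1) w fun f hf => (hker f).1 (hφ f hf))

/-! ### §2. The `A`-algebra `B = A[[T]]/(ā T)` lifts derivations along curvilinear points -/

/-- A `k`-algebra map `ψ : A[[T]] → A_n = k[t]/(t^{n+1})` sends `T` into the maximal ideal: `ψ(T) ≡ 0 mod t`.
(If `ψ(T) ≡ μ ≠ 0`, then `T - μ` is a unit of `A[[T]]` mapped to a non-unit.) [folklore] -/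
private theorem augA_map_X_eq_zero {A : Type u} [CommRing A] [Algebra k A] (n : ℕ)
    (ψ : PowerSeries A →ₐ[k] T1Lifting.A k n) : augA k n (ψ PowerSeries.X) = 0 := by
  by_contra hne
  have hunit : IsUnit (PowerSeries.X - algebraMap k (PowerSeries A) (augA k n (ψ PowerSeries.X))) := by
    rw [PowerSeries.algebraMap_apply, PowerSeries.isUnit_iff_constantCoeff, map_sub, PowerSeries.constantCoeff_X,
      PowerSeries.constantCoeff_C, zero_sub, IsUnit.neg_iff]
    exact (isUnit_iff_ne_zero.2 hne).map _
  have h := (hunit.map ψ).map (augA k n)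
  rw [map_sub, map_sub, AlgHom.commutes, AlgHom.commutes, Algebra.algebraMap_self_apply, sub_self] at h
  exact not_isUnit_zero h

/-- **The `A`-derivations of `B = A[[T]]/(ā·T)` lift along every curvilinear point, as soon as the point kills `ā`**
(the mechanism of [BuchweitzFlenner2003, Rem. 6.9], for an arbitrary commutative `k`-algebra `A` and `b ∈ A`).
Presented on `A[[T]]`: let `ψ : A[[T]] → A_n = k[t]/(t^{n+1})` be a `k`-algebra map with `ψ(b) = 0`, and let
`d : A[[T]] → k` be an `A`-derivation over the point `A[[T]] → A_n → k` (a `k`-linear map, Leibniz along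
`augA ∘ ψ`, vanishing on `A`). Then `d` lifts to an `A`-derivation `δ : A[[T]] → A_n` along `ψ` (Leibniz along
`ψ`, vanishing on `A`) which moreover KILLS THE IDEAL `(b·T)` — so that it is an `A`-derivation of `B` with values
in the `B`-algebra `A_n` whenever `ψ` factors through `B` — and reduces to `d` modulo `t`. The lift is
`δ(f) := ψ(∂f/∂T) · d(T)`: it kills `b·T·g` because `ψ(b) = 0`. [cite: BuchweitzFlenner2003, Rem. 6.9] -/
theorem derivationLifting_of_map_eq_zero {A : Type u} [CommRing A] [Algebra k A] (b : A) (n : ℕ)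
    (ψ : PowerSeries A →ₐ[k] T1Lifting.A k n) (hψb : ψ (PowerSeries.C b) = 0)
    (d : PowerSeries A →ₗ[k] k) (hd : ∀ f g, d (f * g) = augA k n (ψ f) * d g + augA k n (ψ g) * d f)
    (hdA : ∀ x : A, d (PowerSeries.C x) = 0) :
    ∃ δ : PowerSeries A →ₗ[k] T1Lifting.A k n,
      (∀ f g, δ (f * g) = ψ f * δ g + ψ g * δ f) ∧
      (∀ f ∈ Ideal.span {PowerSeries.C b * PowerSeries.X}, δ f = 0) ∧
      (∀ x : A, δ (PowerSeries.C x) = 0) ∧ ∀ f, augA k n (δ f) = d f := by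
  let D : PowerSeries A →ₗ[k] PowerSeries A := (PowerSeries.derivative A).toLinearMap.restrictScalars k
  let δ : PowerSeries A →ₗ[k] T1Lifting.A k n :=
    (LinearMap.mulRight k (algebraMap k (T1Lifting.A k n) (d PowerSeries.X))) ∘ₗ ψ.toLinearMap ∘ₗ D
  have hδ : ∀ f, δ f = ψ (PowerSeries.derivative A f) * algebraMap k (T1Lifting.A k n) (d PowerSeries.X) :=
    fun f => rfl
  have hleib : ∀ f g, δ (f * g) = ψ f * δ g + ψ g * δ f := fun f g => by
    simp only [hδ, Derivation.leibniz, smul_eq_mul, map_add, map_mul]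
    ring
  have hX : augA k n (ψ PowerSeries.X) = 0 := augA_map_X_eq_zero k n ψ
  refine ⟨δ, hleib, fun f hf => ?_, fun x => ?_, fun f => ?_⟩
  · obtain ⟨g, rfl⟩ := Ideal.mem_span_singleton'.1 hf
    have h1 : δ (PowerSeries.C b * PowerSeries.X) = 0 := by
      rw [hδ, Derivation.leibniz, PowerSeries.derivative_C, smul_zero, add_zero, PowerSeries.derivative_X,
        smul_eq_mul, mul_one, hψb, zero_mul]
    rw [hleib, h1, mul_zero, zero_add, map_mul ψ, hψb, zero_mul, zero_mul]
  · rw [hδ, PowerSeries.derivative_C, map_zero, zero_mul]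
  · have hf := PowerSeries.eq_X_mul_shift_add_const f
    set h := PowerSeries.mk fun p => PowerSeries.coeff (p + 1) f
    rw [hδ, map_mul, AlgHom.commutes]
    conv_lhs => rw [hf]
    conv_rhs => rw [hf]
    rw [map_add, PowerSeries.derivative_C, add_zero, Derivation.leibniz, PowerSeries.derivative_X, smul_eq_mul,
      smul_eq_mul, mul_one, map_add, map_mul, map_add, map_mul, hX, zero_mul, zero_add, map_add, hdA, add_zero, hd,
      hX, zero_mul, zero_add, Algebra.algebraMap_self_apply]

/-! ### §3. `B = A[[T]]/(ā T)` is not a power series ring over a quotient of `A` -/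

/-- All coefficients of `φ` in an ideal `𝔫` ⇒ all coefficients of `φ * ψ` in `𝔫`. [folklore] -/
private theorem coeff_mul_mem_of_forall_coeff_mem {S : Type u} [CommRing S] {σ : Type} (𝔫 : Ideal S)
    (φ ψ : MvPowerSeries σ S) (h : ∀ d, MvPowerSeries.coeff d φ ∈ 𝔫) (d : σ →₀ ℕ) :
    MvPowerSeries.coeff d (φ * ψ) ∈ 𝔫 := by
  classical
  rw [MvPowerSeries.coeff_mul]
  exact Ideal.sum_mem _ fun p _ => Ideal.mul_mem_right _ _ (h p.1)

/-- `A → B = A[[T]]/(b·T)` is injective: a constant `x` lies in `(b·T)` only if `x = 0` (constant terms).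
[folklore] -/
private theorem algebraMap_quot_injective {A : Type u} [CommRing A] (b x : A)
    (hx : algebraMap A (PowerSeries A ⧸ Ideal.span {PowerSeries.C b * PowerSeries.X}) x = 0) : x = 0 := by
  rw [← Ideal.Quotient.mk_algebraMap, Ideal.Quotient.eq_zero_iff_mem, Ideal.mem_span_singleton'] at hx
  obtain ⟨g, hg⟩ := hx
  have h := congr_arg PowerSeries.constantCoeff hg
  rwa [map_mul, map_mul, PowerSeries.constantCoeff_X, mul_zero, mul_zero, PowerSeries.algebraMap_apply,
    Algebra.algebraMap_self_apply, PowerSeries.constantCoeff_C, eq_comm] at h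

/-- **`B = A[[T]]/(b·T)` is not smooth over a quotient of `A`** — the negative half of
[BuchweitzFlenner2003, Rem. 6.9], for a LOCAL ring `A` and an element `b ∈ 𝔪_A`, `b ≠ 0`: there is no ideal
`𝔞 ⊆ A` and no `m ≥ 0` with `B ≅ (A/𝔞)[[T_1, …, T_m]]` as `A`-algebras (condition (1) of [BuchweitzFlenner2003,
Lemma 6.8] fails). Proof: `A → B` is injective, so `𝔞 ∋ b` is impossible unless `b = 0`; the image `g` of
the class of `T` satisfies `b·g = 0`; if `m ≥ 1`, writing `T_1 = x + g·h` (`x ∈ A`, as `B = A + T·B`) and comparing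
the coefficients of `T_1` shows that `g` has a unit coefficient (`A/𝔞` is local), whence `b ∈ 𝔞`; if `m = 0`, the
residue class of `T` is a constant `x ∈ A`, so `T - x ∈ (b·T)` and `b` is a unit. [cite: BuchweitzFlenner2003, Rem. 6.9] -/
theorem not_nonempty_algEquiv_mvPowerSeries_quotient {A : Type u} [CommRing A] [IsLocalRing A] {b : A}
    (hb0 : b ≠ 0) (hbu : ¬IsUnit b) (𝔞 : Ideal A) (m : ℕ) :
    ¬Nonempty ((PowerSeries A ⧸ Ideal.span {PowerSeries.C b * PowerSeries.X}) ≃ₐ[A]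
        MvPowerSeries (Fin m) (A ⧸ 𝔞)) := by
  rintro ⟨e⟩
  have hinj := algebraMap_quot_injective b
  -- the class `τ` of `T` and its image `g`
  have hbτ : algebraMap A (PowerSeries A ⧸ Ideal.span {PowerSeries.C b * PowerSeries.X}) b *
      Ideal.Quotient.mk _ PowerSeries.X = 0 := by
    rw [← Ideal.Quotient.mk_algebraMap, ← map_mul, Ideal.Quotient.eq_zero_iff_mem, PowerSeries.algebraMap_apply,
      Algebra.algebraMap_self_apply]
    exact Ideal.subset_span rfl
  have hbg : algebraMap A (MvPowerSeries (Fin m) (A ⧸ 𝔞)) b * e (Ideal.Quotient.mk _ PowerSeries.X) = 0 := by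
    rw [← e.commutes, ← map_mul, hbτ, map_zero]
  have hcoeff : ∀ d, Ideal.Quotient.mk 𝔞 b * MvPowerSeries.coeff d (e (Ideal.Quotient.mk _ PowerSeries.X)) = 0 := by
    intro d
    have h := congr_arg (MvPowerSeries.coeff d) hbg
    rwa [MvPowerSeries.algebraMap_apply, Ideal.Quotient.algebraMap_eq, MvPowerSeries.coeff_C_mul, map_zero] at h
  -- `𝔞` is proper: otherwise `B` would be the zero ring and `1 = 0` in `A`
  have h𝔞 : 𝔞 ≠ ⊤ := by
    intro h
    haveI : Subsingleton (A ⧸ 𝔞) := Ideal.Quotient.subsingleton_iff.2 h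
    haveI : Subsingleton (MvPowerSeries (Fin m) (A ⧸ 𝔞)) := inferInstanceAs (Subsingleton ((Fin m →₀ ℕ) → A ⧸ 𝔞))
    exact one_ne_zero (hinj 1 (e.injective (Subsingleton.elim _ _)))
  haveI : Nontrivial (A ⧸ 𝔞) := Ideal.Quotient.nontrivial_iff.2 h𝔞
  haveI : IsLocalRing (A ⧸ 𝔞) := IsLocalRing.of_surjective' (Ideal.Quotient.mk 𝔞) Ideal.Quotient.mk_surjective
  -- every element of `B` is `x + τ·y` with `x ∈ A`
  have hdec : ∀ z : PowerSeries A ⧸ Ideal.span {PowerSeries.C b * PowerSeries.X}, ∃ (x : A) (y : _),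
      z = algebraMap A _ x + Ideal.Quotient.mk _ PowerSeries.X * y := by
    intro z
    obtain ⟨f, rfl⟩ := Ideal.Quotient.mk_surjective z
    refine ⟨PowerSeries.constantCoeff f, Ideal.Quotient.mk _ (PowerSeries.mk fun p => PowerSeries.coeff (p + 1) f), ?_⟩
    rw [← map_mul, ← Ideal.Quotient.mk_algebraMap, ← map_add, PowerSeries.algebraMap_apply,
      Algebra.algebraMap_self_apply, add_comm]
    exact congr_arg _ (PowerSeries.eq_X_mul_shift_add_const f)
  cases m with
  | zero =>
    -- `g` is a constant: the class of `T` comes from `A`, so `T - x ∈ (b T)` and `b` is a unit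
    obtain ⟨x, hx⟩ := Ideal.Quotient.mk_surjective (MvPowerSeries.coeff 0 (e (Ideal.Quotient.mk _ PowerSeries.X)))
    have hg : e (Ideal.Quotient.mk _ PowerSeries.X) = algebraMap A _ x := by
      rw [MvPowerSeries.algebraMap_apply, Ideal.Quotient.algebraMap_eq, hx]
      ext d
      rw [Subsingleton.elim d 0, MvPowerSeries.coeff_zero_C]
    rw [← e.commutes, e.injective.eq_iff, ← Ideal.Quotient.mk_algebraMap, PowerSeries.algebraMap_apply,
      Algebra.algebraMap_self_apply, ← sub_eq_zero, ← map_sub, Ideal.Quotient.eq_zero_iff_mem,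
      Ideal.mem_span_singleton'] at hg
    obtain ⟨q, hq⟩ := hg
    have h1 := congr_arg (PowerSeries.coeff 1) hq
    rw [← mul_assoc, PowerSeries.coeff_succ_mul_X, PowerSeries.coeff_mul_C, map_sub, PowerSeries.coeff_one_X,
      PowerSeries.coeff_C, if_neg one_ne_zero, sub_zero, mul_comm] at h1
    exact hbu (IsUnit.of_mul_eq_one _ h1)
  | succ m =>
    set g := e (Ideal.Quotient.mk _ PowerSeries.X) with hg_def
    obtain ⟨x, y, hxy⟩ := hdec (e.symm (MvPowerSeries.X 0))
    have hX0 : (MvPowerSeries.X 0 : MvPowerSeries (Fin (m + 1)) (A ⧸ 𝔞)) = algebraMap A _ x + g * e y := by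
      rw [← e.apply_symm_apply (MvPowerSeries.X 0), hxy, map_add, map_mul, e.commutes]
    -- some coefficient of `g` is a unit: compare the coefficients of `T_1` in `T_1 = x + g·y`
    obtain ⟨d₀, hd₀⟩ : ∃ d, IsUnit (MvPowerSeries.coeff d g) := by
      by_contra hnu
      have hall : ∀ d, MvPowerSeries.coeff d g ∈ IsLocalRing.maximalIdeal (A ⧸ 𝔞) := fun d =>
        (IsLocalRing.mem_maximalIdeal _).2 fun hu => hnu ⟨d, hu⟩
      have h1 := congr_arg (MvPowerSeries.coeff (Finsupp.single 0 1)) hX0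
      rw [MvPowerSeries.coeff_index_single_self_X, map_add, MvPowerSeries.algebraMap_apply, MvPowerSeries.coeff_C,
        if_neg (Finsupp.single_ne_zero.2 one_ne_zero), zero_add] at h1
      exact (IsLocalRing.maximalIdeal.isMaximal (A ⧸ 𝔞)).ne_top
        ((Ideal.eq_top_iff_one _).2 (h1 ▸ coeff_mul_mem_of_forall_coeff_mem _ g (e y) hall _))
    have hb𝔞 : Ideal.Quotient.mk 𝔞 b = 0 := (hd₀.mul_left_eq_zero).1 (hcoeff d₀)
    refine hb0 (hinj b (e.injective ?_))
    rw [map_zero, e.commutes, MvPowerSeries.algebraMap_apply, Ideal.Quotient.algebraMap_eq, hb𝔞, map_zero]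

/-! ### §4. [BF03, Remark 6.9] as printed: `A = R/I`, `a ∈ R` integral over `I`, `a ∉ I` -/

/-- An element integral over a proper ideal of `R = k[[X_1, …, X_r]]` lies in the maximal ideal (`a^N ∈ I ⊆ 𝔪_R`).
[folklore] -/
private theorem mem_maximalIdeal_of_isIntegralOver {r : ℕ} {I : Ideal (MvPowerSeries (Fin r) k)} (hI : I ≠ ⊤)
    {a : MvPowerSeries (Fin r) k} {N : ℕ} (c : ℕ → MvPowerSeries (Fin r) k)
    (hc : ∀ j ∈ Finset.Icc 1 N, c j ∈ I ^ j) (ha : a ^ N + ∑ j ∈ Finset.Icc 1 N, c j * a ^ (N - j) = 0) :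
    a ∈ IsLocalRing.maximalIdeal (MvPowerSeries (Fin r) k) := by
  refine (IsLocalRing.maximalIdeal.isMaximal _).isPrime.mem_of_pow_mem N (IsLocalRing.le_maximalIdeal hI ?_)
  rw [add_eq_zero_iff_eq_neg] at ha
  rw [ha]
  refine (Ideal.neg_mem_iff _).2 (Ideal.sum_mem _ fun j hj => Ideal.mul_mem_right _ _ ?_)
  exact Ideal.pow_le_self (Nat.one_le_iff_ne_zero.1 (Finset.mem_Icc.1 hj).1) (hc j hj)

/-- The class of such an `a` is a non-unit of `A = R/I`. [folklore] -/
private theorem not_isUnit_mk_of_isIntegralOver {r : ℕ} {I : Ideal (MvPowerSeries (Fin r) k)} (hI : I ≠ ⊤)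
    {a : MvPowerSeries (Fin r) k} {N : ℕ} (c : ℕ → MvPowerSeries (Fin r) k)
    (hc : ∀ j ∈ Finset.Icc 1 N, c j ∈ I ^ j) (ha : a ^ N + ∑ j ∈ Finset.Icc 1 N, c j * a ^ (N - j) = 0) :
    ¬IsUnit (Ideal.Quotient.mk I a) := by
  intro hu
  obtain ⟨v, hv⟩ := hu.exists_right_inv
  obtain ⟨y, rfl⟩ := Ideal.Quotient.mk_surjective v
  rw [← map_mul, ← map_one (Ideal.Quotient.mk I), Ideal.Quotient.eq, ] at hv
  have h1 : a * y - (a * y - 1) ∈ IsLocalRing.maximalIdeal (MvPowerSeries (Fin r) k) :=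
    Ideal.sub_mem _ (Ideal.mul_mem_right _ _ (mem_maximalIdeal_of_isIntegralOver k hI c hc ha))
      (IsLocalRing.le_maximalIdeal hI hv)
  rw [sub_sub_cancel] at h1
  exact (IsLocalRing.maximalIdeal.isMaximal _).ne_top ((Ideal.eq_top_iff_one _).2 h1)

/-- **[BuchweitzFlenner2003, Remark 6.9] AS PRINTED** («In case `A ≠ ℂ`, the condition (5) above is no longer
equivalent to the other ones as the following example shows. Consider a `ℂ`-algebra `A ≅ R/I`, with
`R ≅ ℂ[[X_1, …, X_k]]`, and assume that there is an element `a ∈ R` that is integral over `I` but not in `I`. If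
`ā` denotes the residue class of `a` in `A`, then the reader may verify that the `A`-algebra `B := A[[T]]/(āT)`
satisfies (5) although it is not smooth over a quotient of `A`.»), over any field `k` in place of `ℂ` and with
formal power series: let `R = k[[X_1, …, X_r]]`, `I ⊆ R` an ideal, `a ∈ R ∖ I` with an equation of integral
dependence `a^N + c_1 a^{N-1} + ⋯ + c_N = 0`, `c_j ∈ I^j`, `A = R/I`, `B = A[[T]]/(ā·T)`. Then
(5)_A holds — for every `n`, every `k`-algebra map `ψ : A[[T]] → A_n = k[t]/(t^{n+1})` (in particular every one
through `B`, i.e. every `B`-algebra structure on the curvilinear algebra `A_n`) and every `A`-derivation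
`d : A[[T]] → k` over the point `augA ∘ ψ`, there is an `A`-derivation `δ : A[[T]] → A_n` along `ψ` killing `(ā·T)`
(so: an `A`-derivation `B → A_n`) with `δ ≡ d mod t`, i.e. `Der_A(B, A_n) → Der_A(B, k)` is onto — although (1)
fails: `B` is not `A`-isomorphic to `(A/𝔞)[[T_1, …, T_m]]` for any ideal `𝔞 ⊆ A` and any `m`.
[cite: BuchweitzFlenner2003, Rem. 6.9] -/
theorem relativeCurvilinearDerivationLifting_and_not_smooth {r : ℕ} (I : Ideal (MvPowerSeries (Fin r) k))
    {a : MvPowerSeries (Fin r) k} (haI : a ∉ I) {N : ℕ} (c : ℕ → MvPowerSeries (Fin r) k)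
    (hc : ∀ j ∈ Finset.Icc 1 N, c j ∈ I ^ j) (ha : a ^ N + ∑ j ∈ Finset.Icc 1 N, c j * a ^ (N - j) = 0) :
    (∀ (n : ℕ) (ψ : PowerSeries (MvPowerSeries (Fin r) k ⧸ I) →ₐ[k] A k n)
        (d : PowerSeries (MvPowerSeries (Fin r) k ⧸ I) →ₗ[k] k),
        (∀ f g, d (f * g) = augA k n (ψ f) * d g + augA k n (ψ g) * d f) →
        (∀ x, d (PowerSeries.C x) = 0) →
        ∃ δ : PowerSeries (MvPowerSeries (Fin r) k ⧸ I) →ₗ[k] A k n,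
          (∀ f g, δ (f * g) = ψ f * δ g + ψ g * δ f) ∧
          (∀ f ∈ Ideal.span {PowerSeries.C (Ideal.Quotient.mk I a) * PowerSeries.X}, δ f = 0) ∧
          (∀ x, δ (PowerSeries.C x) = 0) ∧ ∀ f, augA k n (δ f) = d f) ∧
    ∀ (𝔞 : Ideal (MvPowerSeries (Fin r) k ⧸ I)) (m : ℕ),
      ¬Nonempty ((PowerSeries (MvPowerSeries (Fin r) k ⧸ I) ⧸
          Ideal.span {PowerSeries.C (Ideal.Quotient.mk I a) * PowerSeries.X}) ≃ₐ[MvPowerSeries (Fin r) k ⧸ I]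
        MvPowerSeries (Fin m) ((MvPowerSeries (Fin r) k ⧸ I) ⧸ 𝔞)) := by
  have hI : I ≠ ⊤ := fun h => haI (h ▸ Submodule.mem_top)
  refine ⟨fun n ψ d hd hdA => derivationLifting_of_map_eq_zero k _ n ψ ?_ d hd hdA, fun 𝔞 m => ?_⟩
  · have h := algHom_apply_eq_zero_of_isIntegralOver k I c hc ha n
      (ψ.comp ((IsScalarTower.toAlgHom k (MvPowerSeries (Fin r) k ⧸ I)
        (PowerSeries (MvPowerSeries (Fin r) k ⧸ I))).comp (Ideal.Quotient.mkₐ k I))) fun f hf => by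
        rw [AlgHom.comp_apply, AlgHom.comp_apply, Ideal.Quotient.mkₐ_eq_mk, Ideal.Quotient.eq_zero_iff_mem.2 hf,
          map_zero, map_zero]
    rwa [AlgHom.comp_apply, AlgHom.comp_apply, Ideal.Quotient.mkₐ_eq_mk, IsScalarTower.toAlgHom_apply,
      PowerSeries.algebraMap_apply, Algebra.algebraMap_self_apply] at h
  · haveI : Nontrivial (MvPowerSeries (Fin r) k ⧸ I) := Ideal.Quotient.nontrivial_iff.2 hI
    haveI : IsLocalRing (MvPowerSeries (Fin r) k ⧸ I) :=
      IsLocalRing.of_surjective' (Ideal.Quotient.mk I) Ideal.Quotient.mk_surjective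
    exact not_nonempty_algEquiv_mvPowerSeries_quotient (fun h => haI (Ideal.Quotient.eq_zero_iff_mem.1 h))
      (not_isUnit_mk_of_isIntegralOver k hI c hc ha) 𝔞 m

/-! ### §5. The hypotheses are satisfiable: `R = k[[X, Y]]`, `I = (X², Y²)`, `a = XY` -/

/-- **Non-vacuity of [BuchweitzFlenner2003, Rem. 6.9]'s hypotheses**: in `R = k[[X_0, X_1]]` the element
`a = X_0 X_1` is integral over `I = (X_0², X_1²)` — `a² - X_0² X_1² = 0` with `X_0² X_1² ∈ I²` — but `a ∉ I`
(the coefficient of `X_0 X_1` of every element of `I` vanishes). [cite: BuchweitzFlenner2003, Rem. 6.9] -/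
theorem example_isIntegralOver_not_mem :
    ∃ (I : Ideal (MvPowerSeries (Fin 2) k)) (a : MvPowerSeries (Fin 2) k) (N : ℕ) (c : ℕ → MvPowerSeries (Fin 2) k),
      a ∉ I ∧ (∀ j ∈ Finset.Icc 1 N, c j ∈ I ^ j) ∧ a ^ N + ∑ j ∈ Finset.Icc 1 N, c j * a ^ (N - j) = 0 := by
  refine ⟨Ideal.span {MvPowerSeries.X 0 ^ 2, MvPowerSeries.X 1 ^ 2}, MvPowerSeries.X 0 * MvPowerSeries.X 1, 2,
    fun j => if j = 2 then -(MvPowerSeries.X 0 ^ 2 * MvPowerSeries.X 1 ^ 2) else 0, fun h => ?_, fun j _ => ?_, ?_⟩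
  · obtain ⟨p, q, hpq⟩ := Ideal.mem_span_pair.1 h
    have h1 := congr_arg (MvPowerSeries.coeff (Finsupp.single 0 1 + Finsupp.single 1 1)) hpq
    have hp : MvPowerSeries.coeff (Finsupp.single (0 : Fin 2) 1 + Finsupp.single 1 1)
        (p * MvPowerSeries.X 0 ^ 2 : MvPowerSeries (Fin 2) k) = 0 :=
      MvPowerSeries.X_pow_dvd_iff.1 (dvd_mul_left _ _) _ (by simp)
    have hq : MvPowerSeries.coeff (Finsupp.single (0 : Fin 2) 1 + Finsupp.single 1 1)
        (q * MvPowerSeries.X 1 ^ 2 : MvPowerSeries (Fin 2) k) = 0 :=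
      MvPowerSeries.X_pow_dvd_iff.1 (dvd_mul_left _ _) _ (by simp)
    rw [map_add, hp, hq, add_zero, MvPowerSeries.X_def, MvPowerSeries.X_def, MvPowerSeries.monomial_mul_monomial,
      mul_one, MvPowerSeries.coeff_monomial_same] at h1
    exact zero_ne_one h1
  · dsimp only
    by_cases h2 : j = 2
    · subst h2
      rw [if_pos rfl, pow_two]
      exact (Ideal.neg_mem_iff _).2 (Ideal.mul_mem_mul (Ideal.subset_span (by simp)) (Ideal.subset_span (by simp)))
    · rw [if_neg h2]
      exact zero_mem _
  · rw [show Finset.Icc 1 2 = {1, 2} from by decide, Finset.sum_pair (by decide)]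
    dsimp only
    rw [if_neg (by decide), if_pos rfl]
    ring

end BF03Remark69

/-! ### §6. [BF03, Thm. 9.2 (1)], the inclusion: curvilinear extensions kill the integral closure of `𝔪I` -/

namespace ProRep

open BF03Remark69

/-- An arc `w : P = k[[x_1, …, x_n]] → k[[t]]` (any `k`-algebra map) sends `𝔪_P` into `(t)`: if `w(g)(0) = μ ≠ 0` for
some `g ∈ 𝔪_P`, the unit `g - μ` of `P` would go to the non-unit `w(g) - μ ∈ (t)`. [folklore] -/
private theorem constantCoeff_arc_eq_zero {n : ℕ} (w : MvPowerSeries (Fin n) k →ₐ[k] PowerSeries k)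
    {g : MvPowerSeries (Fin n) k} (hg : g ∈ IsLocalRing.maximalIdeal (MvPowerSeries (Fin n) k)) :
    PowerSeries.constantCoeff (w g) = 0 := by
  by_contra hne
  have hg0 : MvPowerSeries.constantCoeff g = 0 := by
    rw [IsLocalRing.mem_maximalIdeal, mem_nonunits_iff, MvPowerSeries.isUnit_iff_constantCoeff, isUnit_iff_ne_zero,
      not_not] at hg
    exact hg
  have hunit : IsUnit (g - algebraMap k _ (PowerSeries.constantCoeff (w g))) := by
    rw [MvPowerSeries.isUnit_iff_constantCoeff, map_sub, hg0, MvPowerSeries.algebraMap_apply,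
      Algebra.algebraMap_self_apply, MvPowerSeries.constantCoeff_C, zero_sub, IsUnit.neg_iff]
    exact isUnit_iff_ne_zero.2 hne
  have h := PowerSeries.isUnit_constantCoeff _ (hunit.map w)
  rw [map_sub, AlgHom.commutes, PowerSeries.algebraMap_apply, Algebra.algebraMap_self_apply, map_sub,
    PowerSeries.constantCoeff_C, sub_self] at h
  exact not_isUnit_zero h

/-- An arc `w : P → k[[t]]` with `w(I) ⊆ (t^p)` sends `𝔪_P·I` into `(t^{p+1})`. [folklore] -/
private theorem X_pow_succ_dvd_arc_of_mem_maximalIdeal_mul {n : ℕ} (I : Ideal (MvPowerSeries (Fin n) k))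
    (w : MvPowerSeries (Fin n) k →ₐ[k] PowerSeries k) (p : ℕ)
    (hlow : ∀ g ∈ I, (PowerSeries.X : PowerSeries k) ^ p ∣ w g) :
    ∀ f ∈ IsLocalRing.maximalIdeal (MvPowerSeries (Fin n) k) * I, (PowerSeries.X : PowerSeries k) ^ (p + 1) ∣ w f := by
  intro f hf
  have h𝔪 : Ideal.map w (IsLocalRing.maximalIdeal (MvPowerSeries (Fin n) k)) ≤ Ideal.span {(PowerSeries.X : PowerSeries k)} := by
    rw [Ideal.map_le_iff_le_comap]
    intro g hg
    rw [Ideal.mem_comap, Ideal.mem_span_singleton, PowerSeries.X_dvd_iff]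
    exact constantCoeff_arc_eq_zero k w hg
  have hI : Ideal.map w I ≤ Ideal.span {(PowerSeries.X : PowerSeries k) ^ p} := by
    rw [Ideal.map_le_iff_le_comap]
    intro g hg
    rw [Ideal.mem_comap, Ideal.mem_span_singleton]
    exact hlow g hg
  have hmem : w f ∈ Ideal.span {(PowerSeries.X : PowerSeries k)} * Ideal.span {(PowerSeries.X : PowerSeries k) ^ p} := by
    refine Ideal.mul_mono h𝔪 hI ?_
    rw [← Ideal.map_mul]
    exact Ideal.mem_map_of_mem w hf
  rwa [Ideal.span_singleton_mul_span_singleton, Ideal.mem_span_singleton, ← pow_succ'] at hmem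

/-- **[BuchweitzFlenner2003, Thm. 9.2 (1)], proof, «By the valuative criterion of integral dependence mentioned
above, `J` is in the kernel of `p'`»**, in the functor-of-points model: if `x ∈ P = k[[x_1, …, x_n]]` is integral
over `𝔪_P·I` (`x^N + c_1 x^{N-1} + ⋯ + c_N = 0`, `c_j ∈ (𝔪_P I)^j`, p. 204), then EVERY `k`-algebra map
`φ : P → A_{M+1} = k[t]/(t^{M+2})` whose reduction modulo `t^{M+1}` kills `I` — i.e. every lift `p' = (p, φ)` of
`p : P → P/I` to the curvilinear extension `A' = (P/I) ×_{A_M} A_{M+1}` of `P/I` by `k` — kills `x`.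
(Arcs lift; `w(I) ⊆ (t^{M+1})`, `w(𝔪_P) ⊆ (t)`, so `w(𝔪_P I) ⊆ (t^{M+2})` and `w(x) ∈ (t^{M+2})` by the arc
criterion `BF03Remark69.X_pow_dvd_arc_of_isIntegralOver`.) [cite: BuchweitzFlenner2003, Thm. 9.2 (1)] -/
theorem algHom_apply_eq_zero_of_isIntegralOver_maximalIdeal_mul {n : ℕ} (I : Ideal (MvPowerSeries (Fin n) k))
    {x : MvPowerSeries (Fin n) k} {N : ℕ} (c : ℕ → MvPowerSeries (Fin n) k)
    (hc : ∀ j ∈ Finset.Icc 1 N, c j ∈ (IsLocalRing.maximalIdeal (MvPowerSeries (Fin n) k) * I) ^ j)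
    (hx : x ^ N + ∑ j ∈ Finset.Icc 1 N, c j * x ^ (N - j) = 0)
    (M : ℕ) (φ : MvPowerSeries (Fin n) k →ₐ[k] A k (M + 1)) (hφ : ∀ g ∈ I, i k M (φ g) = 0) : φ x = 0 := by
  obtain ⟨w, hw⟩ := T1Lifting.exists_arc_comp_eq k (M + 1) φ
  -- `φ = w mod t^{M+2}`; `i ∘ φ = w mod t^{M+1}`
  have hker : ∀ (L : ℕ) (f : MvPowerSeries (Fin n) k),
      T1Lifting.truncAlg k L (w f) = 0 ↔ (PowerSeries.X : PowerSeries k) ^ (L + 1) ∣ w f := fun L f => by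
    change AdjoinRoot.mk _ (PowerSeries.trunc (L + 1) (w f)) = 0 ↔ _
    rw [AdjoinRoot.mk_eq_zero, Polynomial.X_pow_dvd_iff, PowerSeries.X_pow_dvd_iff]
    refine forall_congr' fun d => imp_congr_right fun hd => ?_
    rw [PowerSeries.coeff_trunc, if_pos hd]
  have hiφ : ∀ f, i k M (φ f) = T1Lifting.truncAlg k M (w f) := fun f => by
    rw [← hw, AlgHom.comp_apply]
    change i k M (AdjoinRoot.mk _ (PowerSeries.trunc (M + 2) (w f))) = AdjoinRoot.mk _ (PowerSeries.trunc (M + 1) (w f))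
    rw [T1Lifting.i_mk, AdjoinRoot.mk_eq_mk]
    refine Polynomial.X_pow_dvd_iff.2 fun d hd => ?_
    rw [Polynomial.coeff_sub, PowerSeries.coeff_trunc, PowerSeries.coeff_trunc, if_pos (Nat.lt_succ_of_lt hd),
      if_pos hd, sub_self]
  have hlow : ∀ g ∈ I, (PowerSeries.X : PowerSeries k) ^ (M + 1) ∣ w g := fun g hg =>
    (hker M g).1 (by rw [← hiφ]; exact hφ g hg)
  rw [← hw, AlgHom.comp_apply, hker]
  exact X_pow_dvd_arc_of_isIntegralOver k _ c hc hx (M + 1 + 1) w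
    (X_pow_succ_dvd_arc_of_mem_maximalIdeal_mul k I w (M + 1) hlow)

/-- **[BuchweitzFlenner2003, THEOREM 9.2 (1)] — the inclusion `Ex^c_{A}(k) ⊆ Hom_A(I/J, k)`, AS PRINTED up to the
dictionary, any field `k`** («THEOREM 9.2. 1. If `k` is algebraically closed then under the isomorphism `(**)`
[`T¹_{A/Λ}(k) ≅ Hom_A(I, k)`] the subspace `Ex^c_{A/Λ}(k)` of `T¹_{A/Λ}(k)` corresponds to the subspace
`Hom_A(I/J, k)` of `Hom_A(I, k)`, where `J` is the integral closure of `𝔪I` in `I`.», p. 205; `Λ = k`, `A = P/I`,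
`P = k[[x_1, …, x_n]]`, `I ⊆ 𝔪_P²`): in the tree's model — `(T²_A)^∨ = I/𝔪_P I` (`ProRep.IModMI`), the curvilinear
extensions of `A` by `k` being the obstructions along the `e_M : A_{M+1} → A_M` of the points of `h_A`, i.e. the
CURVILINEAR OBSTRUCTIONS of [FantechiManetti1998ObstructionCalculus, Def. 3.5] of the obstruction space
`(I/𝔪_P I)^∨` (`ArtinFunctor.powerSeriesPointsObstructionSpace`, `…curvilinearObstructions`) — EVERY CURVILINEAR
OBSTRUCTION `v` VANISHES ON THE CLASS OF EVERY `x ∈ I` INTEGRAL OVER `𝔪_P·I`: `v([x]) = 0`. Print's own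
route: «`J` is in the kernel of `p'`, whence `φ_{A'} ∈ Hom_A(I/J, k)`» = `algHom_apply_eq_zero_of_isIntegralOver_maximalIdeal_mul`
fed into the tree's reading of `ob_e(a)` as `l_φ = p'|I` for any lifting `φ` ([FantechiManetti1998ObstructionCalculus,
proof of Lemma 5.2] = `ProRep.curvilinearObstruction_apply_cls_eq_zero`). Only this inclusion is typed: the printed
EQUALITY needs `k` algebraically closed and the converse («if») half of the arc criterion, neither of which is typed
here.
[cite: BuchweitzFlenner2003, Thm. 9.2 (1)] -/
theorem curvilinearObstruction_apply_cls_eq_zero_of_isIntegralOver {n : ℕ} (I : Ideal (MvPowerSeries (Fin n) k))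
    (hI : I ≤ (IsLocalRing.maximalIdeal (MvPowerSeries (Fin n) k)) ^ 2)
    (v : Module.Dual k (IModMI k (IsLocalRing.maximalIdeal (MvPowerSeries (Fin n) k)) I))
    (hv : v ∈ (ArtinFunctor.powerSeriesPointsObstructionSpace k
        (fun _ _ p hp => points_mvPowerSeries_map_surjective k p hp) I hI).curvilinearObstructions)
    {x : MvPowerSeries (Fin n) k} (hxI : x ∈ I) {N : ℕ} (c : ℕ → MvPowerSeries (Fin n) k)
    (hc : ∀ j ∈ Finset.Icc 1 N, c j ∈ (IsLocalRing.maximalIdeal (MvPowerSeries (Fin n) k) * I) ^ j)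
    (hx : x ^ N + ∑ j ∈ Finset.Icc 1 N, c j * x ^ (N - j) = 0) :
    v (cls k (IsLocalRing.maximalIdeal (MvPowerSeries (Fin n) k)) I x hxI) = 0 :=
  curvilinearObstruction_apply_cls_eq_zero k I hI hxI
    (fun M φ hφ => algHom_apply_eq_zero_of_isIntegralOver_maximalIdeal_mul k I c hc hx M φ hφ) v hv

/-- **[BuchweitzFlenner2003, Thm. 9.2 (1)], subspace form**: the `k`-SUBSPACE generated by the curvilinear
obstructions (print's `Ex^c_{A}(k)`, «the subspace generated by all curvilinear extensions») lies in the annihilator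
of the classes of the elements of `I` integral over `𝔪_P I` (print's `Hom_A(I/J, k) ⊆ Hom_A(I, k)`).
[cite: BuchweitzFlenner2003, Thm. 9.2 (1)] -/
theorem span_curvilinearObstructions_apply_cls_eq_zero_of_isIntegralOver {n : ℕ}
    (I : Ideal (MvPowerSeries (Fin n) k)) (hI : I ≤ (IsLocalRing.maximalIdeal (MvPowerSeries (Fin n) k)) ^ 2)
    (v : Module.Dual k (IModMI k (IsLocalRing.maximalIdeal (MvPowerSeries (Fin n) k)) I))
    (hv : v ∈ Submodule.span k (ArtinFunctor.powerSeriesPointsObstructionSpace k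
        (fun _ _ p hp => points_mvPowerSeries_map_surjective k p hp) I hI).curvilinearObstructions)
    {x : MvPowerSeries (Fin n) k} (hxI : x ∈ I) {N : ℕ} (c : ℕ → MvPowerSeries (Fin n) k)
    (hc : ∀ j ∈ Finset.Icc 1 N, c j ∈ (IsLocalRing.maximalIdeal (MvPowerSeries (Fin n) k) * I) ^ j)
    (hx : x ^ N + ∑ j ∈ Finset.Icc 1 N, c j * x ^ (N - j) = 0) :
    v (cls k (IsLocalRing.maximalIdeal (MvPowerSeries (Fin n) k)) I x hxI) = 0 := by
  induction hv using Submodule.span_induction with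
  | mem u hu => exact curvilinearObstruction_apply_cls_eq_zero_of_isIntegralOver k I hI u hu hxI c hc hx
  | zero => rfl
  | add u u' _ _ hu hu' => rw [LinearMap.add_apply, hu, hu', add_zero]
  | smul a u _ hu => rw [LinearMap.smul_apply, hu, smul_zero]

end ProRep

/-! ### §7. Why (5) is read over `A`: with `Der_k` in place of `Der_A` the Remark's claim fails for the same `B` -/

namespace BF03Remark69

/-- The constant-term map `A[[T]] → A` as a `k`-algebra map. [folklore] -/
private theorem exists_constantCoeff_algHom {A : Type u} [CommRing A] [Algebra k A] :
    ∃ cc : PowerSeries A →ₐ[k] A, ∀ f, cc f = PowerSeries.constantCoeff f :=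
  ⟨{ (PowerSeries.constantCoeff : PowerSeries A →+* A) with
      commutes' := fun c => by
        change PowerSeries.constantCoeff (algebraMap k (PowerSeries A) c) = algebraMap k A c
        rw [PowerSeries.algebraMap_apply, PowerSeries.constantCoeff_C] }, fun _ => rfl⟩

/-- **Honest-scope witness: read with ABSOLUTE derivations `Der_k(−, −)` (the literal wording of (5), which print
states for `A = ℂ` only), the claim of [BuchweitzFlenner2003, Rem. 6.9] FAILS for the Remark's own `B`** — so (5)
in the Remark is to be read over `A`, as (2)–(4) are, which is how §4 types it. Witness (with §5's data
`R = k[[X_0, X_1]]`, `I = (X_0², X_1²)`, `a = X_0X_1` integral over `I`, `a ∉ I`; `2 ≠ 0` in `k`): the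
`B`-algebra structure `ψ : B → k[ε] = k[[X]]/(X²)` (`X_0 ↦ ε`, `X_1 ↦ 0`, `T ↦ 0`; it kills `(ā·T)`), and the `k`-derivation
`d := (ε-part of ψ) : B → k` over the point `B → k[ε] → k` (Leibniz; kills `(ā·T)`); NO `k`-linear `δ : A[[T]] → k[ε]`,
Leibniz along `ψ` — not even one failing to kill `A` or `(ā·T)` — reduces to `d`: from `X_0² = 0` in `A`,
`0 = δ(X_0²) = 2ε·δ(X_0)` while `δ(X_0) ≡ d(X_0) = 1 mod ε`, so `2ε = 0`, absurd. Hence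
`Der_k(B, k[ε]) → Der_k(B, k)` is not onto. [cite: BuchweitzFlenner2003, Rem. 6.9] -/
theorem absoluteDerivationLifting_fails (h2 : (2 : k) ≠ 0) :
    ∃ (ψ : PowerSeries (MvPowerSeries (Fin 2) k ⧸ Ideal.span {MvPowerSeries.X 0 ^ 2, MvPowerSeries.X 1 ^ 2}) →ₐ[k]
        DualNumber k),
      (∀ f ∈ Ideal.span {PowerSeries.C (Ideal.Quotient.mk
          (Ideal.span {(MvPowerSeries.X 0 : MvPowerSeries (Fin 2) k) ^ 2, MvPowerSeries.X 1 ^ 2})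
          (MvPowerSeries.X 0 * MvPowerSeries.X 1)) * PowerSeries.X}, ψ f = 0) ∧
      (∀ f g, TrivSqZeroExt.snd (ψ (f * g)) =
        TrivSqZeroExt.fst (ψ f) * TrivSqZeroExt.snd (ψ g) + TrivSqZeroExt.fst (ψ g) * TrivSqZeroExt.snd (ψ f)) ∧
      ¬∃ δ : PowerSeries (MvPowerSeries (Fin 2) k ⧸ Ideal.span {MvPowerSeries.X 0 ^ 2, MvPowerSeries.X 1 ^ 2}) →ₗ[k]
          DualNumber k,
        (∀ f g, δ (f * g) = ψ f * δ g + ψ g * δ f) ∧ ∀ f, TrivSqZeroExt.fst (δ f) = TrivSqZeroExt.snd (ψ f) := by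
  -- `ψ_R : R → k[ε]`, `X_0 ↦ ε`, `X_1 ↦ 0`
  have h𝔪 : (Ideal.span {(DualNumber.eps : DualNumber k)}) ^ 2 = ⊥ := by
    rw [Ideal.span_singleton_pow, pow_two, DualNumber.eps_mul_eps, Ideal.span_singleton_eq_bot]
  obtain ⟨ψR, -, hψR⟩ := exists_algHom_of_pow_eq_bot k (Ideal.span {(DualNumber.eps : DualNumber k)}) 2
    (by norm_num) h𝔪 ![DualNumber.eps, 0] (fun i => by
      fin_cases i
      · exact Ideal.mem_span_singleton_self _
      · exact zero_mem _)
  have hψ0 : ψR (MvPowerSeries.X 0) = DualNumber.eps := hψR 0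
  have hψ1 : ψR (MvPowerSeries.X 1) = 0 := hψR 1
  have hkerI : ∀ f ∈ Ideal.span {(MvPowerSeries.X 0 : MvPowerSeries (Fin 2) k) ^ 2, MvPowerSeries.X 1 ^ 2},
      ψR f = 0 := fun f hf => by
    obtain ⟨p, q, rfl⟩ := Ideal.mem_span_pair.1 hf
    rw [map_add, map_mul, map_mul, map_pow, map_pow, hψ0, hψ1, pow_two, DualNumber.eps_mul_eps, mul_zero,
      zero_pow two_ne_zero, mul_zero, add_zero]
  obtain ⟨cc, hcc⟩ := exists_constantCoeff_algHom k
    (A := MvPowerSeries (Fin 2) k ⧸ Ideal.span {(MvPowerSeries.X 0 : MvPowerSeries (Fin 2) k) ^ 2, MvPowerSeries.X 1 ^ 2})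
  let ψ := (Ideal.Quotient.liftₐ _ ψR hkerI).comp cc
  have hψC : ∀ x, ψ (PowerSeries.C (Ideal.Quotient.mk _ x)) = ψR x := fun x => by
    change Ideal.Quotient.liftₐ _ ψR hkerI (cc (PowerSeries.C (Ideal.Quotient.mk _ x))) = ψR x
    rw [hcc, PowerSeries.constantCoeff_C, Ideal.Quotient.liftₐ_apply, Ideal.Quotient.lift_mk]
    rfl
  have hψX : ψ PowerSeries.X = 0 := by
    change Ideal.Quotient.liftₐ _ ψR hkerI (cc PowerSeries.X) = 0
    rw [hcc, PowerSeries.constantCoeff_X, map_zero]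
  refine ⟨ψ, fun f hf => ?_, fun f g => ?_, ?_⟩
  · obtain ⟨g, rfl⟩ := Ideal.mem_span_singleton'.1 hf
    rw [map_mul, map_mul, hψX, mul_zero, mul_zero]
  · rw [map_mul, DualNumber.snd_mul, mul_comm (TrivSqZeroExt.snd (ψ f))]
  · rintro ⟨δ, hleib, hfst⟩
    have hx2 : (PowerSeries.C (Ideal.Quotient.mk (Ideal.span {(MvPowerSeries.X 0 : MvPowerSeries (Fin 2) k) ^ 2,
        MvPowerSeries.X 1 ^ 2}) (MvPowerSeries.X 0)) : PowerSeries _) *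
        PowerSeries.C (Ideal.Quotient.mk _ (MvPowerSeries.X 0)) = 0 := by
      rw [← map_mul, ← map_mul, ← pow_two, Ideal.Quotient.eq_zero_iff_mem.2 (Ideal.subset_span (by simp)), map_zero]
    have h0 := congr_arg TrivSqZeroExt.snd (congr_arg δ hx2)
    rw [map_zero, TrivSqZeroExt.snd_zero, hleib, hψC, hψ0, TrivSqZeroExt.snd_add, DualNumber.snd_mul,
      DualNumber.fst_eps, DualNumber.snd_eps, zero_mul, one_mul, zero_add, hfst, hψC, hψ0, DualNumber.snd_eps,
      ← two_mul, mul_one] at h0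
    exact h2 h0

end BF03Remark69

/-! ### §8. Thm 9.2 (1) needs `k` algebraically closed: over `ℝ`, for [FM99, Ex. 2.3]'s `R = ℝ[[x, y]]/(x³, y³, x² + y²)`,
`J/𝔪I = 0` although the curvilinear obstructions span a line only -/

namespace FM99Example23

open MvPowerSeries FM98Example57

/-- `𝔪_P = {constant term 0}` in `P = K[[x, y]]`. [folklore] -/
private theorem mem_maximalIdeal_iff' {K : Type u} [Field K] (f : P2 K) :
    f ∈ IsLocalRing.maximalIdeal (P2 K) ↔ constantCoeff f = 0 := by
  rw [IsLocalRing.mem_maximalIdeal, mem_nonunits_iff, MvPowerSeries.isUnit_iff_constantCoeff, isUnit_iff_ne_zero,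
    not_not]

/-- A `K`-algebra arc `w : K[[x, y]] → K[[t]]` preserves constant terms. [folklore] -/
private theorem constantCoeff_arc {K : Type u} [Field K] (w : P2 K →ₐ[K] PowerSeries K) (g : P2 K) :
    PowerSeries.constantCoeff (w g) = constantCoeff g := by
  have hg : g - algebraMap K (P2 K) (constantCoeff g) ∈ IsLocalRing.maximalIdeal (P2 K) := by
    rw [mem_maximalIdeal_iff', map_sub, MvPowerSeries.algebraMap_apply, Algebra.algebraMap_self_apply,
      MvPowerSeries.constantCoeff_C, sub_self]
  have h := ProRep.constantCoeff_arc_eq_zero K w hg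
  rwa [map_sub, AlgHom.commutes, map_sub, PowerSeries.algebraMap_apply, Algebra.algebraMap_self_apply,
    PowerSeries.constantCoeff_C, sub_eq_zero] at h

/-- The two complex arcs used below, abstractly: if `w : ℂ[[x, y]] → ℂ[[t]]` is a `ℂ`-algebra map with
`w(x³) = t³·e₀`, `w(y³) = t³·e₁`, `w(x² + y²) = t³·e₂`, then for every `x = p·x³ + q·y³ + s·(x² + y²)` integral over
`𝔪·I`, `I = (x³, y³, x² + y²)`: `p(0)·e₀(0) + q(0)·e₁(0) + s(0)·e₂(0) = 0` (`w(𝔪I) ⊆ (t⁴)`, so `t⁴ ∣ w(x) = t³·E`).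
[folklore] -/
private theorem constantCoeff_rel_of_arc (w : P2 ℂ →ₐ[ℂ] PowerSeries ℂ) (e₀ e₁ e₂ : PowerSeries ℂ)
    (h₀ : w (X 0 ^ 3) = PowerSeries.X ^ 3 * e₀) (h₁ : w (X 1 ^ 3) = PowerSeries.X ^ 3 * e₁)
    (h₂ : w (X 0 ^ 2 + X 1 ^ 2) = PowerSeries.X ^ 3 * e₂) (p q s : P2 ℂ) {N : ℕ} (c : ℕ → P2 ℂ)
    (hc : ∀ j ∈ Finset.Icc 1 N, c j ∈ (IsLocalRing.maximalIdeal (P2 ℂ) * I23 ℂ) ^ j)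
    (hx : (p * X 0 ^ 3 + q * X 1 ^ 3 + s * (X 0 ^ 2 + X 1 ^ 2)) ^ N +
      ∑ j ∈ Finset.Icc 1 N, c j * (p * X 0 ^ 3 + q * X 1 ^ 3 + s * (X 0 ^ 2 + X 1 ^ 2)) ^ (N - j) = 0) :
    constantCoeff p * PowerSeries.constantCoeff e₀ + constantCoeff q * PowerSeries.constantCoeff e₁ +
      constantCoeff s * PowerSeries.constantCoeff e₂ = 0 := by
  have hI : ∀ g ∈ I23 ℂ, (PowerSeries.X : PowerSeries ℂ) ^ 3 ∣ w g := by
    intro g hg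
    have hle : Ideal.map w (I23 ℂ) ≤ Ideal.span {(PowerSeries.X : PowerSeries ℂ) ^ 3} := by
      rw [I23, Ideal.map_span, Ideal.span_le]
      rintro _ ⟨g, (rfl | rfl | rfl), rfl⟩
      · exact Ideal.mem_span_singleton.2 ⟨e₀, h₀⟩
      · exact Ideal.mem_span_singleton.2 ⟨e₁, h₁⟩
      · exact Ideal.mem_span_singleton.2 ⟨e₂, h₂⟩
    exact Ideal.mem_span_singleton.1 (hle (Ideal.mem_map_of_mem w hg))
  have hdvd := BF03Remark69.X_pow_dvd_arc_of_isIntegralOver ℂ _ c hc hx (3 + 1) w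
    (ProRep.X_pow_succ_dvd_arc_of_mem_maximalIdeal_mul ℂ (I23 ℂ) w 3 hI)
  have hE : w p * (PowerSeries.X ^ 3 * e₀) + w q * (PowerSeries.X ^ 3 * e₁) + w s * (PowerSeries.X ^ 3 * e₂) =
      PowerSeries.X ^ 3 * (w p * e₀ + w q * e₁ + w s * e₂) := by ring
  rw [map_add, map_add, map_mul, map_mul, map_mul, h₀, h₁, h₂, hE, pow_succ,
    mul_dvd_mul_iff_left (pow_ne_zero 3 PowerSeries.X_ne_zero), PowerSeries.X_dvd_iff] at hdvd
  rwa [map_add, map_add, map_mul, map_mul, map_mul, constantCoeff_arc, constantCoeff_arc, constantCoeff_arc] at hdvd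

/-- The two complex arcs `x ↦ t, y ↦ it` and `x ↦ t + t², y ↦ it` applied to an element
`p·x³ + q·y³ + s·(x² + y²)` of `I ⊆ ℂ[[x, y]]` integral over `𝔪I`: `p(0) − i·q(0) = 0` and
`p(0) − i·q(0) + 2·s(0) = 0`. [folklore] -/
private theorem constantCoeff_rels_complex (p q s : P2 ℂ) {N : ℕ} (c : ℕ → P2 ℂ)
    (hc : ∀ j ∈ Finset.Icc 1 N, c j ∈ (IsLocalRing.maximalIdeal (P2 ℂ) * I23 ℂ) ^ j)
    (hx : (p * X 0 ^ 3 + q * X 1 ^ 3 + s * (X 0 ^ 2 + X 1 ^ 2)) ^ N +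
      ∑ j ∈ Finset.Icc 1 N, c j * (p * X 0 ^ 3 + q * X 1 ^ 3 + s * (X 0 ^ 2 + X 1 ^ 2)) ^ (N - j) = 0) :
    constantCoeff p - constantCoeff q * Complex.I = 0 ∧
      constantCoeff p - constantCoeff q * Complex.I + 2 * constantCoeff s = 0 := by
  have hI : Complex.I ^ 3 = -Complex.I := by rw [pow_succ, Complex.I_sq]; ring
  have hI3 : (PowerSeries.C Complex.I * PowerSeries.X : PowerSeries ℂ) ^ 3 =
      PowerSeries.X ^ 3 * PowerSeries.C (-Complex.I) := by
    rw [mul_pow, ← map_pow, hI, mul_comm]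
  have hI2 : (PowerSeries.C Complex.I * PowerSeries.X : PowerSeries ℂ) ^ 2 = -PowerSeries.X ^ 2 := by
    rw [mul_pow, ← map_pow, Complex.I_sq, map_neg, map_one, neg_one_mul]
  -- arc A: `x ↦ t`, `y ↦ i t`
  have hA : MvPowerSeries.HasSubst (![PowerSeries.X, PowerSeries.C Complex.I * PowerSeries.X] : Fin 2 → PowerSeries ℂ) :=
    MvPowerSeries.hasSubst_of_constantCoeff_zero fun i => by
      fin_cases i
      · exact PowerSeries.constantCoeff_X
      · change PowerSeries.constantCoeff (PowerSeries.C Complex.I * PowerSeries.X) = 0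
        rw [map_mul, PowerSeries.constantCoeff_X, mul_zero]
  have hA0 : MvPowerSeries.substAlgHom hA (X 0 : P2 ℂ) = PowerSeries.X := by
    rw [MvPowerSeries.substAlgHom_X]; rfl
  have hA1 : MvPowerSeries.substAlgHom hA (X 1 : P2 ℂ) = PowerSeries.C Complex.I * PowerSeries.X := by
    rw [MvPowerSeries.substAlgHom_X]; rfl
  have rA := constantCoeff_rel_of_arc (MvPowerSeries.substAlgHom hA) 1 (PowerSeries.C (-Complex.I)) 0
    (by rw [map_pow, hA0, mul_one]) (by rw [map_pow, hA1, hI3])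
    (by rw [map_add, map_pow, map_pow, hA0, hA1, hI2, add_neg_cancel, mul_zero]) p q s c hc hx
  -- arc B: `x ↦ t + t²`, `y ↦ i t`
  have hB : MvPowerSeries.HasSubst
      (![PowerSeries.X + PowerSeries.X ^ 2, PowerSeries.C Complex.I * PowerSeries.X] : Fin 2 → PowerSeries ℂ) :=
    MvPowerSeries.hasSubst_of_constantCoeff_zero fun i => by
      fin_cases i
      · change PowerSeries.constantCoeff (PowerSeries.X + PowerSeries.X ^ 2) = 0
        rw [map_add, map_pow, PowerSeries.constantCoeff_X, zero_pow two_ne_zero, add_zero]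
      · change PowerSeries.constantCoeff (PowerSeries.C Complex.I * PowerSeries.X) = 0
        rw [map_mul, PowerSeries.constantCoeff_X, mul_zero]
  have hB0 : MvPowerSeries.substAlgHom hB (X 0 : P2 ℂ) = PowerSeries.X + PowerSeries.X ^ 2 := by
    rw [MvPowerSeries.substAlgHom_X]; rfl
  have hB1 : MvPowerSeries.substAlgHom hB (X 1 : P2 ℂ) = PowerSeries.C Complex.I * PowerSeries.X := by
    rw [MvPowerSeries.substAlgHom_X]; rfl
  have rB := constantCoeff_rel_of_arc (MvPowerSeries.substAlgHom hB) ((1 + PowerSeries.X) ^ 3)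
    (PowerSeries.C (-Complex.I)) (2 + PowerSeries.X)
    (by rw [map_pow, hB0]; ring) (by rw [map_pow, hB1, hI3])
    (by rw [map_add, map_pow, map_pow, hB0, hB1, hI2]; ring) p q s c hc hx
  simp only [map_one, map_zero, mul_one, mul_zero, add_zero, PowerSeries.constantCoeff_C, map_pow, map_add,
    PowerSeries.constantCoeff_X, one_pow, map_ofNat] at rA rB
  exact ⟨by linear_combination rA, by linear_combination rB⟩

/-- **`J/𝔪I = 0` over `ℝ` for `I = (x³, y³, x² + y²)`**: every element of `I ⊆ ℝ[[x, y]]` integral over `𝔪·I` has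
zero class in `(T²_R)^∨ = I/𝔪I` — the integral closure `J` of `𝔪I` in `I` of [BuchweitzFlenner2003, Thm. 9.2 (1)]
contributes nothing here (base change to `ℂ[[x, y]]`, then the arc criterion along `x ↦ t, y ↦ it` and `x ↦ t + t², y ↦ it`, which
send `I` into `(t³)` and `𝔪I` into `(t⁴)`: the coefficients of `x³, y³, x² + y²` must vanish at `0`). So
`Hom_A(I/J, ℝ)` is ALL of `(I/𝔪I)^∨`. [cite: BuchweitzFlenner2003, Thm. 9.2 (1)]
[cite: FantechiManetti1999T1Lifting, Ex. 2.3] -/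
theorem cls_eq_zero_of_isIntegralOver_real {x : P2 ℝ} (hxI : x ∈ I23 ℝ) {N : ℕ} (c : ℕ → P2 ℝ)
    (hc : ∀ j ∈ Finset.Icc 1 N, c j ∈ (IsLocalRing.maximalIdeal (P2 ℝ) * I23 ℝ) ^ j)
    (hx : x ^ N + ∑ j ∈ Finset.Icc 1 N, c j * x ^ (N - j) = 0) :
    ProRep.cls ℝ (IsLocalRing.maximalIdeal (P2 ℝ)) (I23 ℝ) x hxI = 0 := by
  obtain ⟨p, q, s, hpqs⟩ := Submodule.mem_span_triple.1 hxI
  simp only [smul_eq_mul] at hpqs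
  -- base change to `ℂ`
  have hι𝔪 : Ideal.map (MvPowerSeries.map (algebraMap ℝ ℂ)) (IsLocalRing.maximalIdeal (P2 ℝ)) ≤
      IsLocalRing.maximalIdeal (P2 ℂ) := by
    rw [Ideal.map_le_iff_le_comap]
    intro g hg
    rw [Ideal.mem_comap, mem_maximalIdeal_iff', MvPowerSeries.constantCoeff_map, (mem_maximalIdeal_iff' g).1 hg,
      map_zero]
  have hιI : Ideal.map (MvPowerSeries.map (algebraMap ℝ ℂ)) (I23 ℝ) ≤ I23 ℂ := by
    rw [I23, Ideal.map_span, Ideal.span_le]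
    rintro _ ⟨g, hg, rfl⟩
    rcases hg with rfl | rfl | rfl
    · rw [map_pow, MvPowerSeries.map_X]; exact X_cube_mem ℂ 0
    · rw [map_pow, MvPowerSeries.map_X]; exact X_cube_mem ℂ 1
    · rw [map_add, map_pow, map_pow, MvPowerSeries.map_X, MvPowerSeries.map_X]; exact sq_add_sq_mem ℂ
  have hc' : ∀ j ∈ Finset.Icc 1 N, MvPowerSeries.map (algebraMap ℝ ℂ) (c j) ∈
      (IsLocalRing.maximalIdeal (P2 ℂ) * I23 ℂ) ^ j := fun j hj => by
    have h := Ideal.mem_map_of_mem (MvPowerSeries.map (σ := Fin 2) (algebraMap ℝ ℂ)) (hc j hj)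
    rw [Ideal.map_pow, Ideal.map_mul] at h
    exact Ideal.pow_right_mono (Ideal.mul_mono hι𝔪 hιI) j h
  have hx' := congr_arg (MvPowerSeries.map (σ := Fin 2) (algebraMap ℝ ℂ)) hx
  rw [← hpqs] at hx'
  simp only [map_add, map_sum, map_mul, map_pow, MvPowerSeries.map_X, map_zero] at hx'
  obtain ⟨rA, rB⟩ := constantCoeff_rels_complex _ _ _ _ hc' hx'
  simp only [MvPowerSeries.constantCoeff_map, Complex.coe_algebraMap] at rA rB
  have h1 := congr_arg Complex.re rA
  have h2 := congr_arg Complex.im rA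
  simp only [Complex.sub_re, Complex.sub_im, Complex.mul_re, Complex.mul_im, Complex.I_re, Complex.I_im,
    Complex.ofReal_re, Complex.ofReal_im, mul_zero, mul_one, sub_zero, zero_sub, Complex.zero_re, Complex.zero_im,
    neg_eq_zero, add_zero] at h1 h2
  -- `h1 : p(0) = 0`, `h2 : q(0) = 0`; then `rB` gives `s(0) = 0`
  have h3 := congr_arg Complex.re rB
  simp only [Complex.add_re, Complex.sub_re, Complex.mul_re, Complex.I_re, Complex.I_im,
    Complex.ofReal_re, Complex.ofReal_im, mul_zero, mul_one, sub_zero, Complex.zero_re, h1, Complex.re_ofNat,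
    Complex.im_ofNat, zero_add, mul_eq_zero, OfNat.ofNat_ne_zero, false_or] at h3
  have hp : p ∈ IsLocalRing.maximalIdeal (P2 ℝ) := (mem_maximalIdeal_iff' p).2 h1
  have hq : q ∈ IsLocalRing.maximalIdeal (P2 ℝ) := (mem_maximalIdeal_iff' q).2 h2
  have hs : s ∈ IsLocalRing.maximalIdeal (P2 ℝ) := (mem_maximalIdeal_iff' s).2 h3
  refine ProRep.cls_eq_zero_of_mem hxI ?_
  rw [← hpqs]
  exact add_mem (add_mem (Ideal.mul_mem_mul hp (X_cube_mem ℝ 0)) (Ideal.mul_mem_mul hq (X_cube_mem ℝ 1)))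
    (Ideal.mul_mem_mul hs (sq_add_sq_mem ℝ))

/-- The functional `g ↦ coeff_{x³} g − coeff_{xy²} g` kills `𝔪·I`, `I = (x³, y³, x² + y²)` (on `m·(x² + y²)` the two
coefficients are both the `x`-coefficient of `m`; on `m·x³`, `m·y³`, `m ∈ 𝔪`, both vanish). [folklore] -/
private theorem coeff_functional_eq_zero_of_mem {K : Type u} [Field K] (g : P2 K)
    (hg : g ∈ IsLocalRing.maximalIdeal (P2 K) * I23 K) :
    coeff (Finsupp.single 0 3) g - coeff (Finsupp.single 0 1 + Finsupp.single 1 2) g = 0 := by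
  classical
  refine Submodule.mul_induction_on
    (C := fun g => coeff (Finsupp.single 0 3) g - coeff (Finsupp.single 0 1 + Finsupp.single 1 2) g = 0) hg
    (fun m hm n hn => ?_) (fun u v hu hv => ?_)
  · obtain ⟨a, b, e, rfl⟩ := Submodule.mem_span_triple.1 hn
    have hm0 : constantCoeff m = 0 := (mem_maximalIdeal_iff' m).1 hm
    -- evaluations of the exponent vectors
    have h03 : ¬((Finsupp.single (0 : Fin 2) 3 : Fin 2 →₀ ℕ) ≤ Finsupp.single 0 1 + Finsupp.single 1 2) := fun h => by
      have := h 0; simp at this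
    have h13a : ¬((Finsupp.single (1 : Fin 2) 3 : Fin 2 →₀ ℕ) ≤ Finsupp.single 0 3) := fun h => by
      have := h 1; simp at this
    have h13b : ¬((Finsupp.single (1 : Fin 2) 3 : Fin 2 →₀ ℕ) ≤ Finsupp.single 0 1 + Finsupp.single 1 2) := fun h => by
      have := h 1; simp at this
    have h02a : (Finsupp.single (0 : Fin 2) 2 : Fin 2 →₀ ℕ) ≤ Finsupp.single 0 3 :=
      Finsupp.single_le_iff.2 (by simp)
    have h02b : ¬((Finsupp.single (0 : Fin 2) 2 : Fin 2 →₀ ℕ) ≤ Finsupp.single 0 1 + Finsupp.single 1 2) := fun h => by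
      have := h 0; simp at this
    have h12a : ¬((Finsupp.single (1 : Fin 2) 2 : Fin 2 →₀ ℕ) ≤ Finsupp.single 0 3) := fun h => by
      have := h 1; simp at this
    have h12b : (Finsupp.single (1 : Fin 2) 2 : Fin 2 →₀ ℕ) ≤ Finsupp.single 0 1 + Finsupp.single 1 2 :=
      Finsupp.single_le_iff.2 (by simp)
    have hsub1 : (Finsupp.single (0 : Fin 2) 3 : Fin 2 →₀ ℕ) - Finsupp.single 0 2 = Finsupp.single 0 1 := by
      ext i; fin_cases i <;> simp
    have hsub2 : (Finsupp.single (0 : Fin 2) 1 + Finsupp.single 1 2 : Fin 2 →₀ ℕ) - Finsupp.single 1 2 =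
        Finsupp.single 0 1 := by
      ext i; fin_cases i <;> simp
    simp only [smul_eq_mul, mul_add, map_add, ← mul_assoc]
    rw [X_pow_eq, X_pow_eq, X_pow_eq, X_pow_eq, coeff_mul_monomial, coeff_mul_monomial, coeff_mul_monomial,
      coeff_mul_monomial, coeff_mul_monomial, coeff_mul_monomial, coeff_mul_monomial, coeff_mul_monomial,
      if_pos le_rfl, tsub_self, if_neg h13a, if_pos h02a, if_neg h12a, if_neg h03, if_neg h13b, if_neg h02b,
      if_pos h12b, hsub1, hsub2, MvPowerSeries.coeff_zero_eq_constantCoeff_apply, map_mul, hm0]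
    ring
  · rw [map_add, map_add]; linear_combination hu + hv

/-- `[x³] ≠ 0` in `(T²_R)^∨ = I/𝔪I` for `I = (x³, y³, x² + y²)` (any field). [cite: FantechiManetti1999T1Lifting, Ex. 2.3] -/
theorem cls_X_cube_ne_zero {K : Type u} [Field K] :
    ProRep.cls K (IsLocalRing.maximalIdeal (P2 K)) (I23 K) (X 0 ^ 3) (X_cube_mem K 0) ≠ 0 := by
  classical
  intro h
  have hmem : (X 0 : P2 K) ^ 3 ∈ IsLocalRing.maximalIdeal (P2 K) * I23 K := by
    unfold ProRep.cls at h
    rw [Submodule.Quotient.mk_eq_zero] at h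
    exact (Submodule.restrictScalars_mem K _ _).1 h
  have h0 := coeff_functional_eq_zero_of_mem _ hmem
  have hne : (Finsupp.single (0 : Fin 2) 1 + Finsupp.single 1 2 : Fin 2 →₀ ℕ) ≠ Finsupp.single 0 3 := fun h => by
    have := congr_arg (fun f => f 1) h; simp at this
  rw [X_pow_eq, coeff_monomial_same, coeff_monomial_ne hne, sub_zero] at h0
  exact one_ne_zero h0

/-- **[BuchweitzFlenner2003, Thm. 9.2 (1)] NEEDS `k` ALGEBRAICALLY CLOSED — the equality fails over `ℝ`** for
[FantechiManetti1999T1Lifting, Ex. 2.3]'s `R = ℝ[[x, y]]/(x³, y³, x² + y²)` (print's own sharpness example for its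
Thm. 2.2: «If `k` is not algebraically closed then theorem 2.2 may fail … Then `x³, y³ ∈ T²∨_R` are in the kernel of
every curvilinear obstruction; hence `dim R = 0`, `dim T¹_R = 2`, `dim T^{2c}_R = 1`»; cf. the cousin
[FantechiManetti1998ObstructionCalculus, Ex. 5.7 (iii)] and p. 562 «if `k` is not algebraically closed then
Proposition 5.8 may fail»; [BuchweitzFlenner2003] itself prints 9.2 (1) under «If `k` is algebraically closed» with
no sharpness remark — the necessity below is this file's): by
`cls_eq_zero_of_isIntegralOver_real`, `J/𝔪I = 0`, so `Hom_A(I/J, ℝ)` is the whole of `(T²_R) = (I/𝔪I)^∨`; but the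
span of the curvilinear obstructions (`Ex^c`) misses every functional not killing `[x³] ≠ 0` (tree:
`FM99Example23.apply_cls_cube_eq_zero_of_mem_span`; it is a line, `FM99Example23.finrank_span_curvilinearObstructions`).
So `Ex^c ⊊ Hom_A(I/J, k)` here: the inclusion typed in §6 is all that holds without `k = k̄`.
[cite: BuchweitzFlenner2003, Thm. 9.2 (1)] [cite: FantechiManetti1999T1Lifting, Ex. 2.3] -/
theorem curvilinearObstructions_span_lt_annihilator_real :
    (∀ (x : P2 ℝ) (hxI : x ∈ I23 ℝ) (N : ℕ) (c : ℕ → P2 ℝ),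
        (∀ j ∈ Finset.Icc 1 N, c j ∈ (IsLocalRing.maximalIdeal (P2 ℝ) * I23 ℝ) ^ j) →
        x ^ N + ∑ j ∈ Finset.Icc 1 N, c j * x ^ (N - j) = 0 →
        ∀ v : Module.Dual ℝ (ProRep.IModMI ℝ (IsLocalRing.maximalIdeal (P2 ℝ)) (I23 ℝ)),
          v (ProRep.cls ℝ (IsLocalRing.maximalIdeal (P2 ℝ)) (I23 ℝ) x hxI) = 0) ∧
    ∃ v : Module.Dual ℝ (ProRep.IModMI ℝ (IsLocalRing.maximalIdeal (P2 ℝ)) (I23 ℝ)),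
      v ∉ Submodule.span ℝ (T2R ℝ).curvilinearObstructions := by
  refine ⟨fun x hxI N c hc hx v => by rw [cls_eq_zero_of_isIntegralOver_real hxI c hc hx, map_zero], ?_⟩
  by_contra hall
  apply cls_X_cube_ne_zero (K := ℝ)
  rw [← Module.forall_dual_apply_eq_zero_iff ℝ]
  intro v
  by_contra hv
  exact hall ⟨v, fun hmem => hv (apply_cls_cube_eq_zero_of_mem_span ℝ 0 v hmem)⟩

end FM99Example23

/-! ### §9. (1) ⇒ (5) over an arbitrary base: power series rings over `A'` DO lift `A'`-derivations — so Rem. 6.9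
separates (5)_A from (1) strictly -/

namespace BF03Remark69

open Literature.RingTheory.MvPowerSeries (pd pd_mul pd_C pd_X)

/-- `f = f(0) + Σ_j X_j·g_j` in `R[[X_1, …, X_m]]`, any commutative ring `R` (put into `g_j` the monomials whose first
variable is `X_j`). [folklore] -/
private theorem exists_eq_C_add_sum_X_mul {R : Type u} [CommRing R] {m : ℕ} (f : MvPowerSeries (Fin m) R) :
    ∃ g : Fin m → MvPowerSeries (Fin m) R,
      f = MvPowerSeries.C (MvPowerSeries.constantCoeff f) + ∑ j, MvPowerSeries.X j * g j := by
  classical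
  let g : Fin m → MvPowerSeries (Fin m) R := fun j e =>
    if ∀ i < j, e i = 0 then MvPowerSeries.coeff (e + Finsupp.single j 1) f else 0
  have hg : ∀ j e, MvPowerSeries.coeff e (g j) =
      if ∀ i < j, e i = 0 then MvPowerSeries.coeff (e + Finsupp.single j 1) f else 0 := fun j e => rfl
  refine ⟨g, ?_⟩
  ext e
  rw [map_add, map_sum, MvPowerSeries.coeff_C]
  simp only [MvPowerSeries.X, MvPowerSeries.coeff_monomial_mul, one_mul]
  by_cases he : e = 0
  · subst he
    rw [if_pos rfl, Finset.sum_eq_zero fun j _ => ?_, add_zero, MvPowerSeries.coeff_zero_eq_constantCoeff_apply]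
    rw [if_neg]
    intro h
    have := h j
    simp at this
  · rw [if_neg he, zero_add]
    have hne : e.support.Nonempty := Finsupp.support_nonempty_iff.2 he
    set j₀ := e.support.min' hne with hj₀
    have hj₀mem : e j₀ ≠ 0 := Finsupp.mem_support_iff.1 (Finset.min'_mem _ hne)
    have hj₀min : ∀ i < j₀, e i = 0 := fun i hi => by
      by_contra h
      exact absurd (Finset.min'_le _ i (Finsupp.mem_support_iff.2 h)) (not_le.2 hi)
    rw [Finset.sum_eq_single j₀]
    · have hle : Finsupp.single j₀ 1 ≤ e := Finsupp.single_le_iff.2 (Nat.one_le_iff_ne_zero.2 hj₀mem)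
      rw [if_pos hle, hg, if_pos, tsub_add_cancel_of_le hle]
      intro i hi
      rw [Finsupp.tsub_apply, Finsupp.single_eq_of_ne (ne_of_lt hi), tsub_zero, hj₀min i hi]
    · intro j _ hj
      by_cases hle : Finsupp.single j 1 ≤ e
      · rw [if_pos hle, hg, if_neg]
        intro hall
        rcases lt_or_gt_of_ne hj with hlt | hgt
        · -- j < j₀: then e j = 0, contradicting `single j 1 ≤ e`
          exact absurd (Finsupp.single_le_iff.1 hle) (by rw [hj₀min j hlt]; exact Nat.not_succ_le_zero 0)
        · -- j₀ < j: `hall j₀` says (e - single j 1) j₀ = 0, but it is e j₀ ≠ 0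
          have := hall j₀ hgt
          rw [Finsupp.tsub_apply, Finsupp.single_eq_of_ne (ne_of_lt hgt), tsub_zero] at this
          exact hj₀mem this
      · rw [if_neg hle]
    · exact fun h => absurd (Finset.mem_univ j₀) h

/-- A `k`-algebra map `ψ : A'[[X_1, …, X_m]] → A_n` sends the variables into the maximal ideal. [folklore] -/
private theorem augA_map_mvX_eq_zero {A' : Type u} [CommRing A'] [Algebra k A'] {m : ℕ} (n : ℕ)
    (ψ : MvPowerSeries (Fin m) A' →ₐ[k] T1Lifting.A k n) (j : Fin m) : augA k n (ψ (MvPowerSeries.X j)) = 0 := by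
  by_contra hne
  have hunit : IsUnit (MvPowerSeries.X j - algebraMap k (MvPowerSeries (Fin m) A') (augA k n (ψ (MvPowerSeries.X j)))) := by
    rw [MvPowerSeries.algebraMap_apply, MvPowerSeries.isUnit_iff_constantCoeff, map_sub, MvPowerSeries.constantCoeff_X,
      MvPowerSeries.constantCoeff_C, zero_sub, IsUnit.neg_iff]
    exact (isUnit_iff_ne_zero.2 hne).map _
  have h := (hunit.map ψ).map (augA k n)
  rw [map_sub, map_sub, AlgHom.commutes, AlgHom.commutes, Algebra.algebraMap_self_apply, sub_self] at h
  exact not_isUnit_zero h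

/-- **[BuchweitzFlenner2003, Lemma 6.8], (1) ⇒ (5) OVER AN ARBITRARY BASE** («The implications (1) ⇒ (2) ⇒ (3) ⇒
(4) ⇒ (5) are obvious», p. 184 — printed for `A = ℂ`; here (5) read over the base as in §4): for any commutative
`k`-algebra `A'` (think `A' = A/𝔞`) and `B = A'[[X_1, …, X_m]]` — i.e. `B` OF THE FORM (1) — every `A'`-derivation
`d : B → k` over the point of a `k`-algebra map `ψ : B → A_n = k[t]/(t^{n+1})` (a `k`-linear map, Leibniz along
`augA ∘ ψ`, vanishing on `A'`) lifts to an `A'`-derivation `δ : B → A_n` along `ψ` with `augA ∘ δ = d`, namely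
`δ(f) = Σ_i ψ(∂f/∂X_i)·d(X_i)` (the tree's coefficientwise `∂/∂X_i = Literature.RingTheory.MvPowerSeries.pd i`);
that `augA ∘ δ = d` uses `f = f(0) + Σ_j X_j g_j` and `ψ(X_j) ≡ 0 mod t`. With §4 (Rem. 6.9: (5)_A ∧ ¬(1)) this makes
the Remark's «no longer equivalent» precise as typed: over `A ≠ k`, (1) ⇒ (5)_A STRICTLY.
[cite: BuchweitzFlenner2003, Lemma 6.8 and Rem. 6.9] -/
theorem derivationLifting_mvPowerSeries {A' : Type u} [CommRing A'] [Algebra k A'] {m : ℕ} (n : ℕ)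
    (ψ : MvPowerSeries (Fin m) A' →ₐ[k] T1Lifting.A k n) (d : MvPowerSeries (Fin m) A' →ₗ[k] k)
    (hd : ∀ f g, d (f * g) = augA k n (ψ f) * d g + augA k n (ψ g) * d f)
    (hdA : ∀ x : A', d (MvPowerSeries.C x) = 0) :
    ∃ δ : MvPowerSeries (Fin m) A' →ₗ[k] T1Lifting.A k n,
      (∀ f g, δ (f * g) = ψ f * δ g + ψ g * δ f) ∧ (∀ x : A', δ (MvPowerSeries.C x) = 0) ∧
        ∀ f, augA k n (δ f) = d f := by
  classical
  let δ : MvPowerSeries (Fin m) A' →ₗ[k] T1Lifting.A k n :=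
    ∑ i : Fin m, (LinearMap.mulRight k (algebraMap k (T1Lifting.A k n) (d (MvPowerSeries.X i)))) ∘ₗ
      ψ.toLinearMap ∘ₗ (pd i).restrictScalars k
  have hδ : ∀ f, δ f = ∑ i : Fin m, ψ (pd i f) * algebraMap k (T1Lifting.A k n) (d (MvPowerSeries.X i)) :=
    fun f => by simp only [δ, LinearMap.sum_apply, LinearMap.comp_apply, LinearMap.mulRight_apply]; rfl
  have hX : ∀ j, augA k n (ψ (MvPowerSeries.X j)) = 0 := augA_map_mvX_eq_zero k n ψ
  refine ⟨δ, fun f g => ?_, fun x => ?_, fun f => ?_⟩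
  · rw [hδ, hδ, hδ, Finset.mul_sum, Finset.mul_sum, ← Finset.sum_add_distrib]
    refine Finset.sum_congr rfl fun i _ => ?_
    rw [pd_mul, map_add, map_mul, map_mul]
    ring
  · rw [hδ]
    exact Finset.sum_eq_zero fun i _ => by rw [pd_C, map_zero, zero_mul]
  · obtain ⟨g, hf⟩ := exists_eq_C_add_sum_X_mul f
    -- `d f = Σ_j augA(ψ g_j) · d(X_j)`
    have hdf : d f = ∑ j, augA k n (ψ (g j)) * d (MvPowerSeries.X j) := by
      conv_lhs => rw [hf]
      rw [map_add, hdA, zero_add, map_sum]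
      exact Finset.sum_congr rfl fun j _ => by rw [hd, hX, zero_mul, zero_add]
    -- `augA (ψ (∂f/∂X_i)) = augA (ψ g_i)`
    have hpd : ∀ i, augA k n (ψ (pd i f)) = augA k n (ψ (g i)) := by
      intro i
      conv_lhs => rw [hf]
      rw [map_add, pd_C, zero_add, map_sum, map_sum, map_sum]
      rw [Finset.sum_eq_single i]
      · rw [pd_mul, pd_X, if_pos rfl, one_mul, map_add, map_mul, map_add, map_mul, hX, zero_mul, add_zero]
      · intro j _ hji
        rw [pd_mul, pd_X, if_neg hji, zero_mul, zero_add, map_mul, map_mul, hX, zero_mul]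
      · exact fun h => absurd (Finset.mem_univ i) h
    rw [hδ, map_sum, hdf]
    exact Finset.sum_congr rfl fun i _ => by rw [map_mul, AlgHom.commutes, Algebra.algebraMap_self_apply, hpd]

end BF03Remark69

/-! ### §10. … whereas over `ℂ` the equality of Thm. 9.2 (1) holds for the same `I`: the curvilinear obstructions of
`ℂ[[x, y]]/(x³, y³, x² + y²)` span all of `T²_R` -/

namespace FM99Example23

open MvPowerSeries FM98Example57

/-- An arc `w : ℂ[[x, y]] → ℂ[[t]]` with `w(I) ⊆ (t³)` defines the curvilinear obstruction `[g] ↦ coeff_{t³} w(g)` of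
`R = ℂ[[x, y]]/(x³, y³, x² + y²)` ([FantechiManetti1998ObstructionCalculus, Lemma 5.5], «if» direction: tree
`ProRep.mem_curvilinearObstructions_iff_exists_powerSeries_arc`). [cite: FantechiManetti1998ObstructionCalculus, Lemma 5.5] -/
theorem exists_curvilinearObstruction_of_arc (w : P2 ℂ →ₐ[ℂ] PowerSeries ℂ)
    (hw : ∀ g ∈ I23 ℂ, (PowerSeries.X : PowerSeries ℂ) ^ 3 ∣ w g) :
    ∃ v ∈ (T2R ℂ).curvilinearObstructions,
      ∀ (g : P2 ℂ) (hg : g ∈ I23 ℂ),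
        v (ProRep.cls ℂ (IsLocalRing.maximalIdeal (P2 ℂ)) (I23 ℂ) g hg) = PowerSeries.coeff 3 (w g) := by
  -- the functional `g ↦ coeff₃ (w g)` on `I`, which kills `𝔪I` (`w(𝔪I) ⊆ (t⁴)`)
  let f : ↥((I23 ℂ).restrictScalars ℂ) →ₗ[ℂ] ℂ :=
    (PowerSeries.coeff 3) ∘ₗ w.toLinearMap ∘ₗ ((I23 ℂ).restrictScalars ℂ).subtype
  have hf : ∀ x : ↥((I23 ℂ).restrictScalars ℂ), f x = PowerSeries.coeff 3 (w x) := fun x => rfl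
  have hker : ProRep.mI ℂ (IsLocalRing.maximalIdeal (P2 ℂ)) (I23 ℂ) ≤ LinearMap.ker f := by
    intro x hx
    rw [LinearMap.mem_ker, hf]
    have h4 := ProRep.X_pow_succ_dvd_arc_of_mem_maximalIdeal_mul ℂ (I23 ℂ) w 3 hw x
      ((Submodule.restrictScalars_mem ℂ _ _).1 hx)
    exact (PowerSeries.X_pow_dvd_iff.1 h4) 3 (by norm_num)
  let v : Module.Dual ℂ (ProRep.IModMI ℂ (IsLocalRing.maximalIdeal (P2 ℂ)) (I23 ℂ)) := Submodule.liftQ _ f hker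
  have hv : ∀ (g : P2 ℂ) (hg : g ∈ I23 ℂ),
      v (ProRep.cls ℂ (IsLocalRing.maximalIdeal (P2 ℂ)) (I23 ℂ) g hg) = PowerSeries.coeff 3 (w g) := fun g hg => by
    change Submodule.liftQ _ f hker (Submodule.Quotient.mk _) = _
    rw [Submodule.liftQ_apply]
    rfl
  refine ⟨v, ?_, hv⟩
  rw [show T2R ℂ = ArtinFunctor.powerSeriesPointsObstructionSpace ℂ
      (fun _ _ p hp => points_mvPowerSeries_map_surjective ℂ p hp) (I23 ℂ) (I23_le_sq ℂ) from rfl,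
    ProRep.mem_curvilinearObstructions_iff_exists_powerSeries_arc]
  refine ⟨3, by norm_num, w, 1, fun g hg d hd => (PowerSeries.X_pow_dvd_iff.1 (hw g hg)) d hd, fun g hg => ?_⟩
  rw [hv, one_mul]

/-- **Over `ℂ` the equality of [BuchweitzFlenner2003, Thm. 9.2 (1)] holds for [FantechiManetti1999T1Lifting, Ex. 2.3]'s
ring: the curvilinear obstructions of `R = ℂ[[x, y]]/(x³, y³, x² + y²)` SPAN ALL of `T²_R = (I/𝔪I)^∨`** (contrast
§8 over `ℝ`, where they span a line): the arcs `(t, it)`, `(t, −it)`, `(t + t², it)` give the curvilinear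
obstructions with values `(1, −i, 0)`, `(1, i, 0)`, `(1, −i, 2)` on `[x³], [y³], [x² + y²]`, three independent vectors,
and a form on `T²∨_R` is determined by these three values (tree `FM99Example23.dual_eq_zero_of_apply_cls_eq_zero`). With
`J/𝔪I = 0` (§8's argument, now over `ℂ`) this is `Ex^c = Hom_A(I/J, ℂ)` as 9.2 (1) predicts; [FantechiManetti1999T1Lifting,
Ex. 2.3]: «Similar examples can be constructed whenever the base field `k` is not algebraically closed.»
[cite: BuchweitzFlenner2003, Thm. 9.2 (1)] [cite: FantechiManetti1999T1Lifting, Ex. 2.3] -/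
theorem span_curvilinearObstructions_eq_top_complex :
    Submodule.span ℂ (T2R ℂ).curvilinearObstructions = ⊤ := by
  have hI : Complex.I ^ 3 = -Complex.I := by rw [pow_succ, Complex.I_sq]; ring
  have hI3 : (PowerSeries.C Complex.I * PowerSeries.X : PowerSeries ℂ) ^ 3 =
      PowerSeries.X ^ 3 * PowerSeries.C (-Complex.I) := by rw [mul_pow, ← map_pow, hI, mul_comm]
  have hI3' : (PowerSeries.C (-Complex.I) * PowerSeries.X : PowerSeries ℂ) ^ 3 =
      PowerSeries.X ^ 3 * PowerSeries.C Complex.I := by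
    rw [mul_pow, ← map_pow, neg_pow, hI, mul_comm]; norm_num
  have hI2 : (PowerSeries.C Complex.I * PowerSeries.X : PowerSeries ℂ) ^ 2 = -PowerSeries.X ^ 2 := by
    rw [mul_pow, ← map_pow, Complex.I_sq, map_neg, map_one, neg_one_mul]
  have hI2' : (PowerSeries.C (-Complex.I) * PowerSeries.X : PowerSeries ℂ) ^ 2 = -PowerSeries.X ^ 2 := by
    rw [mul_pow, ← map_pow, neg_sq, Complex.I_sq, map_neg, map_one, neg_one_mul]
  -- generic: an arc with prescribed values `w(x³) = t³e₀`, `w(y³) = t³e₁`, `w(x²+y²) = t³e₂` yields a curvilinear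
  -- obstruction with values `(e₀(0), e₁(0), e₂(0))`
  have harc : ∀ (a : Fin 2 → PowerSeries ℂ) (ha : MvPowerSeries.HasSubst a) (e₀ e₁ e₂ : PowerSeries ℂ),
      a 0 ^ 3 = PowerSeries.X ^ 3 * e₀ → a 1 ^ 3 = PowerSeries.X ^ 3 * e₁ → a 0 ^ 2 + a 1 ^ 2 = PowerSeries.X ^ 3 * e₂ →
      ∃ v ∈ (T2R ℂ).curvilinearObstructions,
        v (ProRep.cls ℂ (IsLocalRing.maximalIdeal (P2 ℂ)) (I23 ℂ) (X 0 ^ 3) (X_cube_mem ℂ 0)) =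
            PowerSeries.constantCoeff e₀ ∧
          v (ProRep.cls ℂ (IsLocalRing.maximalIdeal (P2 ℂ)) (I23 ℂ) (X 1 ^ 3) (X_cube_mem ℂ 1)) =
            PowerSeries.constantCoeff e₁ ∧
          v (ProRep.cls ℂ (IsLocalRing.maximalIdeal (P2 ℂ)) (I23 ℂ) (X 0 ^ 2 + X 1 ^ 2) (sq_add_sq_mem ℂ)) =
            PowerSeries.constantCoeff e₂ := by
    intro a ha e₀ e₁ e₂ h₀ h₁ h₂
    have h0' : MvPowerSeries.substAlgHom ha (X 0 ^ 3 : P2 ℂ) = PowerSeries.X ^ 3 * e₀ := by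
      rw [map_pow, MvPowerSeries.substAlgHom_X, h₀]
    have h1' : MvPowerSeries.substAlgHom ha (X 1 ^ 3 : P2 ℂ) = PowerSeries.X ^ 3 * e₁ := by
      rw [map_pow, MvPowerSeries.substAlgHom_X, h₁]
    have h2' : MvPowerSeries.substAlgHom ha (X 0 ^ 2 + X 1 ^ 2 : P2 ℂ) = PowerSeries.X ^ 3 * e₂ := by
      rw [map_add, map_pow, map_pow, MvPowerSeries.substAlgHom_X, MvPowerSeries.substAlgHom_X, h₂]
    have hw : ∀ g ∈ I23 ℂ, (PowerSeries.X : PowerSeries ℂ) ^ 3 ∣ MvPowerSeries.substAlgHom ha g := by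
      intro g hg
      have hle : Ideal.map (MvPowerSeries.substAlgHom ha) (I23 ℂ) ≤ Ideal.span {(PowerSeries.X : PowerSeries ℂ) ^ 3} := by
        rw [I23, Ideal.map_span, Ideal.span_le]
        rintro _ ⟨g, (rfl | rfl | rfl), rfl⟩
        · exact Ideal.mem_span_singleton.2 ⟨e₀, h0'⟩
        · exact Ideal.mem_span_singleton.2 ⟨e₁, h1'⟩
        · exact Ideal.mem_span_singleton.2 ⟨e₂, h2'⟩
      exact Ideal.mem_span_singleton.1 (hle (Ideal.mem_map_of_mem _ hg))
    obtain ⟨v, hv, hval⟩ := exists_curvilinearObstruction_of_arc (MvPowerSeries.substAlgHom ha) hw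
    have hc3 : ∀ e : PowerSeries ℂ, PowerSeries.coeff 3 (PowerSeries.X ^ 3 * e) = PowerSeries.constantCoeff e := fun e => by
      rw [PowerSeries.coeff_X_pow_mul', if_pos le_rfl, Nat.sub_self, PowerSeries.coeff_zero_eq_constantCoeff_apply]
    exact ⟨v, hv, by rw [hval, h0', hc3], by rw [hval, h1', hc3], by rw [hval, h2', hc3]⟩
  -- the three arcs
  have hA : MvPowerSeries.HasSubst (![PowerSeries.X, PowerSeries.C Complex.I * PowerSeries.X] : Fin 2 → PowerSeries ℂ) :=
    MvPowerSeries.hasSubst_of_constantCoeff_zero fun i => by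
      fin_cases i
      · exact PowerSeries.constantCoeff_X
      · change PowerSeries.constantCoeff (PowerSeries.C Complex.I * PowerSeries.X) = 0
        rw [map_mul, PowerSeries.constantCoeff_X, mul_zero]
  have hA' : MvPowerSeries.HasSubst (![PowerSeries.X, PowerSeries.C (-Complex.I) * PowerSeries.X] : Fin 2 → PowerSeries ℂ) :=
    MvPowerSeries.hasSubst_of_constantCoeff_zero fun i => by
      fin_cases i
      · exact PowerSeries.constantCoeff_X
      · change PowerSeries.constantCoeff (PowerSeries.C (-Complex.I) * PowerSeries.X) = 0
        rw [map_mul, PowerSeries.constantCoeff_X, mul_zero]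
  have hB : MvPowerSeries.HasSubst
      (![PowerSeries.X + PowerSeries.X ^ 2, PowerSeries.C Complex.I * PowerSeries.X] : Fin 2 → PowerSeries ℂ) :=
    MvPowerSeries.hasSubst_of_constantCoeff_zero fun i => by
      fin_cases i
      · change PowerSeries.constantCoeff (PowerSeries.X + PowerSeries.X ^ 2) = 0
        rw [map_add, map_pow, PowerSeries.constantCoeff_X, zero_pow two_ne_zero, add_zero]
      · change PowerSeries.constantCoeff (PowerSeries.C Complex.I * PowerSeries.X) = 0
        rw [map_mul, PowerSeries.constantCoeff_X, mul_zero]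
  obtain ⟨vA, hvA, hA0, hA1, hA2⟩ := harc _ hA 1 (PowerSeries.C (-Complex.I)) 0
    (by change PowerSeries.X ^ 3 = _; rw [mul_one])
    (by change (PowerSeries.C Complex.I * PowerSeries.X) ^ 3 = _; rw [hI3])
    (by change PowerSeries.X ^ 2 + (PowerSeries.C Complex.I * PowerSeries.X) ^ 2 = _; rw [hI2, add_neg_cancel, mul_zero])
  obtain ⟨vA', hvA', hA'0, hA'1, hA'2⟩ := harc _ hA' 1 (PowerSeries.C Complex.I) 0
    (by change PowerSeries.X ^ 3 = _; rw [mul_one])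
    (by change (PowerSeries.C (-Complex.I) * PowerSeries.X) ^ 3 = _; rw [hI3'])
    (by change PowerSeries.X ^ 2 + (PowerSeries.C (-Complex.I) * PowerSeries.X) ^ 2 = _; rw [hI2', add_neg_cancel, mul_zero])
  obtain ⟨vB, hvB, hB0, hB1, hB2⟩ := harc _ hB ((1 + PowerSeries.X) ^ 3) (PowerSeries.C (-Complex.I)) (2 + PowerSeries.X)
    (by change (PowerSeries.X + PowerSeries.X ^ 2) ^ 3 = _; ring)
    (by change (PowerSeries.C Complex.I * PowerSeries.X) ^ 3 = _; rw [hI3])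
    (by change (PowerSeries.X + PowerSeries.X ^ 2) ^ 2 + (PowerSeries.C Complex.I * PowerSeries.X) ^ 2 = _; rw [hI2]; ring)
  simp only [map_one, map_zero, PowerSeries.constantCoeff_C, map_pow, map_add, PowerSeries.constantCoeff_X, add_zero,
    one_pow, map_ofNat] at hA0 hA1 hA2 hA'0 hA'1 hA'2 hB0 hB1 hB2
  -- every form is a combination of `vA, vA', vB`
  rw [eq_top_iff]
  rintro φ -
  set α := φ (ProRep.cls ℂ (IsLocalRing.maximalIdeal (P2 ℂ)) (I23 ℂ) (X 0 ^ 3) (X_cube_mem ℂ 0))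
  set β := φ (ProRep.cls ℂ (IsLocalRing.maximalIdeal (P2 ℂ)) (I23 ℂ) (X 1 ^ 3) (X_cube_mem ℂ 1))
  set γ := φ (ProRep.cls ℂ (IsLocalRing.maximalIdeal (P2 ℂ)) (I23 ℂ) (X 0 ^ 2 + X 1 ^ 2) (sq_add_sq_mem ℂ))
  have hφ : φ = ((α + Complex.I * β - γ) / 2) • vA + ((α - Complex.I * β) / 2) • vA' + (γ / 2) • vB := by
    rw [← sub_eq_zero]
    refine dual_eq_zero_of_apply_cls_eq_zero ℂ _ (fun s => ?_) ?_
    · fin_cases s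
      · change (φ - _) (ProRep.cls ℂ _ _ (X 0 ^ 3) (X_cube_mem ℂ 0)) = 0
        simp only [LinearMap.sub_apply, LinearMap.add_apply, LinearMap.smul_apply, hA0, hA'0, hB0, smul_eq_mul]
        change α - _ = 0
        ring
      · change (φ - _) (ProRep.cls ℂ _ _ (X 1 ^ 3) (X_cube_mem ℂ 1)) = 0
        simp only [LinearMap.sub_apply, LinearMap.add_apply, LinearMap.smul_apply, hA1, hA'1, hB1, smul_eq_mul]
        change β - _ = 0
        linear_combination β * Complex.I_sq
    · change (φ - _) (ProRep.cls ℂ _ _ (X 0 ^ 2 + X 1 ^ 2) (sq_add_sq_mem ℂ)) = 0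
      simp only [LinearMap.sub_apply, LinearMap.add_apply, LinearMap.smul_apply, hA2, hA'2, hB2, smul_eq_mul]
      change γ - _ = 0
      ring
  rw [hφ]
  exact add_mem (add_mem (Submodule.smul_mem _ _ (Submodule.subset_span hvA))
    (Submodule.smul_mem _ _ (Submodule.subset_span hvA'))) (Submodule.smul_mem _ _ (Submodule.subset_span hvB))

end FM99Example23

end Literature.AlgebraicGeometry.Deformation
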